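import Literature.Barriers.RiemannHypothesis.TuranPartialSumsBoxCert
import HarnessLib

/-!
# Sections of `ζ` beyond `σ = 1`: the box checker — soundness

Barrier catalogue `Literature/Barriers/RiemannHypothesis/`, companion of `TuranPartialSumsBoxCert.lean`
(the checker). This file proves that an accepted run proves the claim:

* the analytic heart (term and group enclosures): on a box (`σ ∈ [σ⁻, σ⁺]`,
  `θ_p ∈ 2π[a_p, a_p+1]/2^{L_p}`), for every group of terms accumulated by `BoxCert.accTerms`,
  `S² Σ_t mono_t(z) = U + δθ₂ V₂ + δθ₃ V₃ + δθ₅ V₅ + E`, `|E| ≤ dr (S + ε) + rh ε + t (S + ε)/S²`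
  (`BoxCert.group_enclosure`; `U, V_p, dr, rh, t` the integer accumulators, `δθ_p` the deviations
  from the centre angles, `ε = epsT`; the second-order term from `|e^{iδ} − 1 − iδ| ≤ δ²`,
  `|δ| ≤ 1`, Mathlib's `Complex.norm_exp_sub_one_sub_id_le`);
* `BoxCert.evalBox_sound` — an accepted box satisfies the claim pointwise: from the group
  enclosures `S²G_q = U_q + L_q + E_q`, the lower bound `|U + L + E| ≥ |U| + Re(ŪL)/|U| − |E|`, the
  upper bound `|U + L + E| ≤ |U| + Re(ŪL)/|U| + |L|²/(2|U|) + |E|`, and the signed combination of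
  the linear terms over the groups (an invariant of `BoxCert.stepGroups`);
* `BoxCert.search_sound` — the bisection is sound (induction on fuel; children cover the box).

The covering of the fundamental domain by the initial cells, the compiled evaluations and the
discharge are in `TuranPartialSumsAssemblyCert.lean`.

## References

* [PlattTrudgian2016] D. J. Platt, T. S. Trudgian, *Zeroes of partial sums of the zeta-function*,
  LMS J. Comput. Math. 19 (2016), 37–41, §2.2–§2.3.
-/

open Complex
open Literature.Analysis.ValidatedNumerics.NumericsMP
open Literature.Analysis.ValidatedNumerics (Numerics.cdiv Numerics.div_le_cdiv Numerics.fdiv_le_div)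
open scoped ComplexConjugate

namespace Literature.Barriers.RiemannHypothesis

namespace BoxCert


/-! ## Angles: centres, half-widths, table indices -/

/-- The centre angle `π(2a+1)/2^L` of the arc `2π[a, a+1]/2^L`. [folklore] -/
noncomputable def thetaC (L a : ℕ) : ℝ := Real.pi * (2 * a + 1) / 2 ^ L

/-- A point of the arc is within `π/2^L` of its centre. [folklore] -/
theorem abs_sub_thetaC_le {L a : ℕ} {θ : ℝ} (h1 : 2 * Real.pi * a / 2 ^ L ≤ θ)
    (h2 : θ ≤ 2 * Real.pi * (a + 1) / 2 ^ L) : |θ - thetaC L a| ≤ Real.pi / 2 ^ L := by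
  rw [thetaC, abs_le]
  constructor
  · have : 2 * Real.pi * a / 2 ^ L - Real.pi * (2 * a + 1) / 2 ^ L = -(Real.pi / 2 ^ L) := by ring
    linarith
  · have : 2 * Real.pi * (a + 1) / 2 ^ L - Real.pi * (2 * a + 1) / 2 ^ L = Real.pi / 2 ^ L := by ring
    linarith

/-- The table index of the centre: `2π · midOf L a / 2^14 = π(2a+1)/2^L` for `L ≤ 13`. [folklore] -/
theorem midOf_angle {L : ℕ} (hL : L ≤ 13) (a : ℕ) :
    2 * Real.pi * (midOf L a : ℝ) / 16384 = thetaC L a := by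
  rw [midOf, M, Nat.shiftLeft_eq, thetaC]
  have hL' : (2 : ℝ) ^ L ≠ 0 := pow_ne_zero _ two_ne_zero
  have h2 : (2 : ℝ) ^ (14 - 1 - L) = 2 ^ 13 / 2 ^ L := by
    rw [eq_div_iff hL', ← pow_add]
    congr 1
    omega
  push_cast
  rw [h2]
  ring

/-- `hOf c L ≥ π S / 2^L`. [folklore] -/
theorem hOf_ge {c : Ctx} (hc : c.Valid) (L : ℕ) : Real.pi * S0 / 2 ^ L ≤ (hOf c L : ℝ) := by
  rw [hOf]
  have h1 : (c.piS : ℝ) / (2 ^ L : ℕ) ≤ (Numerics.cdiv c.piS (2 ^ L) : ℝ) := by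
    have := Numerics.div_le_cdiv (a := c.piS) (b := 2 ^ L) (by positivity)
    exact_mod_cast this
  have h2 : (Numerics.cdiv c.piS (2 ^ L) : ℝ) ≤ ((Numerics.cdiv c.piS (2 ^ L)).toNat : ℝ) := by
    exact_mod_cast Int.self_le_toNat _
  refine le_trans ?_ (h1.trans h2)
  push_cast
  exact div_le_div_of_nonneg_right hc.piS (by positivity)

/-- Periodicity of the table angle: `e^{2πi (m mod 2^14)/2^14} = e^{2πi m/2^14}`. [folklore] -/
theorem cexp_mod (m : ℕ) :
    cexp (↑(2 * Real.pi * (m % 16384 : ℕ) / 16384) * I) = cexp (↑(2 * Real.pi * m / 16384) * I) := by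
  have hm : (m : ℝ) = 16384 * (m / 16384 : ℕ) + (m % 16384 : ℕ) := by
    exact_mod_cast (Nat.div_add_mod m 16384).symm
  conv_rhs => rw [hm]
  push_cast
  rw [show (2 * ↑Real.pi * (16384 * ↑(m / 16384) + ↑(m % 16384)) / 16384 * I : ℂ) =
      ↑(m / 16384 : ℕ) * (2 * Real.pi * I) + 2 * Real.pi * ↑(m % 16384) / 16384 * I by ring,
    Complex.exp_add, Complex.exp_nat_mul_two_pi_mul_I, one_mul]

/-! ## The value of a term on the torus -/

/-- `(p^{-σ} e^{iθ})^k = p^{-σ k}… : z_p^k` as modulus times phase. [folklore] -/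
theorem zOf_pow (p k : ℕ) (σ θ : ℝ) :
    zOf p σ θ ^ k = ((((p : ℝ) ^ k : ℝ) ^ (-σ) : ℝ) : ℂ) * cexp (↑(k * θ) * I) := by
  rw [zOf, mul_pow, ← ofReal_pow, ← Complex.exp_nat_mul, ← Real.rpow_mul_natCast (by positivity),
    mul_comm (-σ) k, Real.rpow_natCast_mul (by positivity)]
  push_cast
  ring_nf

/-- **Value of a term**: `mono_t(z(σ, θ)) = (2^a 3^b 5^c)^{-σ} · e^{i(aθ₂ + bθ₃ + cθ₅)}`.
[folklore] -/
theorem mono_zOf (t : Term) (σ θ₂ θ₃ θ₅ : ℝ) :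
    t.mono (zOf 2 σ θ₂) (zOf 3 σ θ₃) (zOf 5 σ θ₅) =
      ((((t.smooth : ℕ) : ℝ) ^ (-σ) : ℝ) : ℂ) * cexp (↑(t.a * θ₂ + t.b * θ₃ + t.c * θ₅) * I) := by
  rw [Term.mono, zOf_pow, zOf_pow, zOf_pow, Term.smooth]
  have h2 : (0 : ℝ) ≤ (2 : ℝ) ^ t.a := by positivity
  have h3 : (0 : ℝ) ≤ (3 : ℝ) ^ t.b := by positivity
  have h5 : (0 : ℝ) ≤ (5 : ℝ) ^ t.c := by positivity
  push_cast
  rw [Real.mul_rpow (mul_nonneg h2 h3) h5, Real.mul_rpow h2 h3]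
  push_cast
  rw [show ((t.a : ℂ) * θ₂ + t.b * θ₃ + t.c * θ₅) * I = t.a * θ₂ * I + t.b * θ₃ * I + t.c * θ₅ * I by
    ring, Complex.exp_add, Complex.exp_add]
  ring

/-! ## Compiled terms -/

/-- `|X − rc| ≤ dr` for `lo ≤ X ≤ hi`, `rc = ⌊(lo+hi)/2⌋`, `dr = max (hi − rc) (rc − lo)`. [folklore] -/
theorem abs_sub_mid_le {lo hi : ℤ} {X : ℝ} (h1 : (lo : ℝ) ≤ X) (h2 : X ≤ hi) :
    |X - (((lo + hi) / 2 : ℤ) : ℝ)| ≤ (max (hi - (lo + hi) / 2) ((lo + hi) / 2 - lo) : ℤ) := by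
  rw [abs_le]
  push_cast
  constructor
  · have : (((lo + hi) / 2 : ℤ) : ℝ) - lo ≤ max ((hi : ℝ) - (((lo + hi) / 2 : ℤ) : ℝ))
        ((((lo + hi) / 2 : ℤ) : ℝ) - lo) := le_max_right _ _
    linarith
  · have : (hi : ℝ) - (((lo + hi) / 2 : ℤ) : ℝ) ≤ max ((hi : ℝ) - (((lo + hi) / 2 : ℤ) : ℝ))
        ((((lo + hi) / 2 : ℤ) : ℝ) - lo) := le_max_left _ _
    linarith

/-- **A compiled term encloses the magnitude**: for `σ` in the `σ`-interval of a valid table and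
`1 ≤ n = 2^a 3^b 5^c ≤ 28`: `|S n^{-σ} − rc| ≤ dr`, `S n^{-σ} ≤ rhi`, `0 ≤ rc`. [folklore] -/
theorem compileTerm_spec {ls js : ℕ} {mag : Array (ℕ × ℕ × ℕ × ℕ)} (hm : MagValid ls js mag)
    {t : Term} (h1 : 1 ≤ t.smooth) (h28 : t.smooth ≤ 28) {σ : ℝ} (hσ1 : sigLo ls js ≤ σ)
    (hσ2 : σ ≤ sigHi ls js) :
    |S0 * ((t.smooth : ℕ) : ℝ) ^ (-σ) - (compileTerm mag t).rc| ≤ (compileTerm mag t).dr ∧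
      S0 * ((t.smooth : ℕ) : ℝ) ^ (-σ) ≤ (compileTerm mag t).rhi ∧
      (0 : ℝ) ≤ (compileTerm mag t).rc ∧
      (compileTerm mag t).a = t.a ∧ (compileTerm mag t).b = t.b ∧ (compileTerm mag t).c = t.c := by
  set n := t.smooth with hn
  have hn1 : (1 : ℝ) ≤ n := by exact_mod_cast h1
  have hlo : ((mag.getD n default).2.2.1 : ℝ) ≤ S0 * (n : ℝ) ^ (-σ) :=
    (hm.lo2 n h1 h28).trans (mul_le_mul_of_nonneg_left
      (Real.rpow_le_rpow_of_exponent_le hn1 (by linarith)) (by positivity))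
  have hhi : S0 * (n : ℝ) ^ (-σ) ≤ ((mag.getD n default).2.1 : ℝ) :=
    le_trans (mul_le_mul_of_nonneg_left
      (Real.rpow_le_rpow_of_exponent_le hn1 (by linarith)) (by positivity)) (hm.hi1 n h1 h28)
  simp only [compileTerm]
  refine ⟨?_, by exact_mod_cast hhi, ?_, trivial, trivial, trivial⟩
  · have := abs_sub_mid_le (lo := ((mag.getD n default).2.2.1 : ℤ)) (hi := ((mag.getD n default).2.1 : ℤ))
      (X := S0 * (n : ℝ) ^ (-σ)) (by exact_mod_cast hlo) (by exact_mod_cast hhi)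
    exact_mod_cast this
  · have h0 : (0 : ℤ) ≤ (((mag.getD n default).2.2.1 : ℤ) + ((mag.getD n default).2.1 : ℤ)) / 2 :=
      Int.ediv_nonneg (by positivity) (by norm_num)
    exact_mod_cast h0

/-! ## The second-order decomposition of one term -/

/-- **Decomposition of a term.** With `|Sρ − rc| ≤ dr`, `Sρ ≤ rhi`, `0 ≤ rc`, `|S w₀ − C| ≤ ε`,
`|w₀| = 1`, `|δ| S ≤ H ≤ S`:
`|S² ρ w₀ e^{iδ} − rc C − δ (rc C i)| ≤ rc (S + ε)(H/S)² + dr (S + ε) + rhi ε`. [folklore] -/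
theorem term_decomp {S ε H ρ rc rhi dr δ : ℝ} (hS : 0 < S) (hρ : 0 ≤ ρ) (hrc : |S * ρ - rc| ≤ dr)
    (hrhi : S * ρ ≤ rhi) (hrc0 : 0 ≤ rc) {w₀ C : ℂ} (hw : ‖w₀‖ = 1) (hC : ‖(S : ℂ) * w₀ - C‖ ≤ ε)
    (hδ : |δ| * S ≤ H) (hH : H ≤ S) :
    ‖(S : ℂ) ^ 2 * (ρ * (w₀ * cexp (δ * I))) - rc * C - δ * (rc * C * I)‖ ≤
      rc * (S + ε) * (H / S) ^ 2 + dr * (S + ε) + rhi * ε := by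
  have hε : 0 ≤ ε := le_trans (norm_nonneg _) hC
  set η : ℂ := (S : ℂ) * w₀ - C with hη
  set q : ℂ := cexp (δ * I) - 1 - δ * I with hq
  have hδ1 : |δ| ≤ H / S := by rwa [le_div_iff₀ hS]
  have hδ1' : |δ| ≤ 1 := hδ1.trans (by rwa [div_le_one hS])
  have hqn : ‖q‖ ≤ (H / S) ^ 2 := by
    have h1 : ‖(δ : ℂ) * I‖ ≤ 1 := by simpa using hδ1'
    have := Complex.norm_exp_sub_one_sub_id_le h1
    rw [← hq] at this
    refine this.trans ?_
    have : ‖(δ : ℂ) * I‖ = |δ| := by simp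
    rw [this]
    exact pow_le_pow_left₀ (abs_nonneg _) hδ1 2
  have hCn : ‖C‖ ≤ S + ε := by
    have : C = (S : ℂ) * w₀ - η := by rw [hη]; ring
    rw [this]
    refine (norm_sub_le _ _).trans ?_
    rw [norm_mul, Complex.norm_real, Real.norm_eq_abs, abs_of_pos hS, hw, mul_one]
    linarith
  have he : ‖cexp (δ * I)‖ = 1 := norm_exp_ofReal_mul_I δ
  -- the identity
  have key : (S : ℂ) ^ 2 * (ρ * (w₀ * cexp (δ * I))) - rc * C - δ * (rc * C * I) =
      rc * C * q + (S * ρ - rc) * C * cexp (δ * I) + S * ρ * η * cexp (δ * I) := by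
    rw [hq, hη]; ring
  rw [key]
  refine (norm_add₃_le).trans ?_
  have e1 : ‖(rc : ℂ) * C * q‖ ≤ rc * (S + ε) * (H / S) ^ 2 := by
    rw [norm_mul, norm_mul, Complex.norm_real, Real.norm_eq_abs, abs_of_nonneg hrc0]
    exact mul_le_mul (mul_le_mul_of_nonneg_left hCn hrc0) hqn (norm_nonneg _) (by positivity)
  have e2 : ‖((S : ℂ) * ρ - rc) * C * cexp (δ * I)‖ ≤ dr * (S + ε) := by
    rw [norm_mul, norm_mul, he, mul_one]
    have : ‖(S : ℂ) * ρ - rc‖ = |S * ρ - rc| := by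
      rw [show (S : ℂ) * ρ - rc = ((S * ρ - rc : ℝ) : ℂ) by push_cast; ring, Complex.norm_real,
        Real.norm_eq_abs]
    rw [this]
    exact mul_le_mul hrc hCn (norm_nonneg _) (le_trans (abs_nonneg _) hrc)
  have e3 : ‖(S : ℂ) * ρ * η * cexp (δ * I)‖ ≤ rhi * ε := by
    rw [norm_mul, norm_mul, he, mul_one]
    have : ‖(S : ℂ) * ρ‖ = S * ρ := by
      rw [← ofReal_mul, Complex.norm_real, Real.norm_eq_abs, abs_of_nonneg (by positivity)]
    rw [this]
    exact mul_le_mul hrhi hC (norm_nonneg _) (le_trans (by positivity) hrhi)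
  linarith

/-! ## The group enclosure -/

section Group

variable {c : Ctx} {m2 m3 m5 h2 h3 h5 : ℕ}

/-- The table index of a compiled term on the box. [folklore] -/
def idx (m2 m3 m5 : ℕ) (t : CTerm) : ℕ := (t.a * m2 + t.b * m3 + t.c * m5) % 16384

/-- The scaled phase half-width `H_n` of a compiled term on the box. [folklore] -/
def Hn (h2 h3 h5 : ℕ) (t : CTerm) : ℕ := t.a * h2 + t.b * h3 + t.c * h5

/-- One accumulation step, field by field. [folklore] -/
theorem accTerm_eq (c : Ctx) (m2 m3 m5 h2 h3 h5 : ℕ) (g : GAcc) (t : CTerm) :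
    accTerm c m2 m3 m5 h2 h3 h5 g t =
      ⟨g.ux + t.rc * (c.cosT.getD (idx m2 m3 m5 t) default).1,
        g.uy + t.rc * (c.cosT.getD (idx m2 m3 m5 t) default).2,
        g.v2x - t.a * (t.rc * (c.cosT.getD (idx m2 m3 m5 t) default).2),
        g.v2y + t.a * (t.rc * (c.cosT.getD (idx m2 m3 m5 t) default).1),
        g.v3x - t.b * (t.rc * (c.cosT.getD (idx m2 m3 m5 t) default).2),
        g.v3y + t.b * (t.rc * (c.cosT.getD (idx m2 m3 m5 t) default).1),
        g.v5x - t.c * (t.rc * (c.cosT.getD (idx m2 m3 m5 t) default).2),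
        g.v5y + t.c * (t.rc * (c.cosT.getD (idx m2 m3 m5 t) default).1),
        g.t + t.rc * ((Hn h2 h3 h5 t : ℤ) * (Hn h2 h3 h5 t : ℤ)), g.dr + t.dr, g.rh + t.rhi,
        g.sh2 + t.rc * t.a * h2 * (Hn h2 h3 h5 t : ℤ), g.sh3 + t.rc * t.b * h3 * (Hn h2 h3 h5 t : ℤ),
        g.sh5 + t.rc * t.c * h5 * (Hn h2 h3 h5 t : ℤ),
        g.ok && decide (Hn h2 h3 h5 t ≤ 268435456)⟩ := rfl

/-- The flag is monotone: if the final flag is set, so was the initial one. [folklore] -/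
theorem accTerms_ok {c : Ctx} {m2 m3 m5 h2 h3 h5 : ℕ} :
    ∀ (ts : List CTerm) (g : GAcc), (accTerms c m2 m3 m5 h2 h3 h5 ts g).ok = true → g.ok = true
  | [], g, h => h
  | t :: ts, g, h => by
    have := accTerms_ok ts _ h
    rw [accTerm_eq] at this
    simp only [Bool.and_eq_true] at this
    exact this.1

/-- A Gaussian integer as a complex number. [folklore] -/
def gz (x y : ℤ) : ℂ := (x : ℂ) + (y : ℂ) * I

/-- `gz` is additive. [folklore] -/
theorem gz_add (a b c d : ℤ) : gz (a + b) (c + d) = gz a c + gz b d := by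
  simp only [gz]; push_cast; ring

/-- `gz` is homogeneous. [folklore] -/
theorem gz_smul (k a b : ℤ) : gz (k * a) (k * b) = (k : ℂ) * gz a b := by
  simp only [gz]; push_cast; ring

/-- Rotation by `i`: `k · (gz a b · i) = gz (−kb) (ka)`. [folklore] -/
theorem gz_rot (k a b : ℤ) : gz (-(k * b)) (k * a) = (k : ℂ) * (gz a b * I) := by
  simp only [gz]; push_cast
  linear_combination (-(k : ℂ) * b) * I_mul_I

/-- Linear bookkeeping of one induction step. [folklore] -/
theorem step_identity {S mono rest U1 U V W X d2 d3 d5 Et E' : ℂ} {a b cc : ℕ}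
    (ht : S ^ 2 * mono = U1 + ((a : ℂ) * d2 + (b : ℂ) * d3 + (cc : ℂ) * d5) * (U1 * I) + Et)
    (hr : S ^ 2 * rest = U + d2 * V + d3 * W + d5 * X + E') :
    S ^ 2 * (mono + rest) = (U1 + U) + d2 * ((a : ℂ) * (U1 * I) + V) +
      d3 * ((b : ℂ) * (U1 * I) + W) + d5 * ((cc : ℂ) * (U1 * I) + X) + (Et + E') := by
  linear_combination ht + hr

variable (hc : c.Valid) {ls js : ℕ} {mag : Array (ℕ × ℕ × ℕ × ℕ)} (hm : MagValid ls js mag)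
  {L2 L3 L5 a2 a3 a5 : ℕ} (hL2 : L2 ≤ 13) (hL3 : L3 ≤ 13) (hL5 : L5 ≤ 13)
  {σ θ₂ θ₃ θ₅ : ℝ} (hσ1 : sigLo ls js ≤ σ) (hσ2 : σ ≤ sigHi ls js)
  (h2l : 2 * Real.pi * a2 / 2 ^ L2 ≤ θ₂) (h2u : θ₂ ≤ 2 * Real.pi * (a2 + 1) / 2 ^ L2)
  (h3l : 2 * Real.pi * a3 / 2 ^ L3 ≤ θ₃) (h3u : θ₃ ≤ 2 * Real.pi * (a3 + 1) / 2 ^ L3)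
  (h5l : 2 * Real.pi * a5 / 2 ^ L5 ≤ θ₅) (h5u : θ₅ ≤ 2 * Real.pi * (a5 + 1) / 2 ^ L5)

include hc hm hL2 hL3 hL5 hσ1 hσ2 h2l h2u h3l h3u h5l h5u in
/-- **Decomposition of a compiled term on the box** (the instance of `term_decomp`): with the
centre indices `m_p = midOf L_p a_p`, half-widths `h_p = hOf c L_p`, `δθ_p = θ_p − θ⁰_p`, and
`C` the table entry at the term's index,
`|S² mono_t − rc C − (a δθ₂ + b δθ₃ + c δθ₅)(rc C i)| ≤ rc (S+ε)(H_n/S)² + dr (S+ε) + rhi ε`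
provided `H_n ≤ S`. [folklore] -/
theorem cterm_decomp {t : Term} (h1 : 1 ≤ t.smooth) (h28 : t.smooth ≤ 28)
    (hH : Hn (hOf c L2) (hOf c L3) (hOf c L5) (compileTerm mag t) ≤ 268435456) :
    ‖(S0 : ℂ) ^ 2 * t.mono (zOf 2 σ θ₂) (zOf 3 σ θ₃) (zOf 5 σ θ₅) -
        (compileTerm mag t).rc *
          gz (c.cosT.getD (idx (midOf L2 a2) (midOf L3 a3) (midOf L5 a5) (compileTerm mag t))
            default).1 (c.cosT.getD (idx (midOf L2 a2) (midOf L3 a3) (midOf L5 a5)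
            (compileTerm mag t)) default).2 -
        ((t.a : ℂ) * ↑(θ₂ - thetaC L2 a2) + (t.b : ℂ) * ↑(θ₃ - thetaC L3 a3) +
          (t.c : ℂ) * ↑(θ₅ - thetaC L5 a5)) * ((compileTerm mag t).rc *
          gz (c.cosT.getD (idx (midOf L2 a2) (midOf L3 a3) (midOf L5 a5) (compileTerm mag t))
            default).1 (c.cosT.getD (idx (midOf L2 a2) (midOf L3 a3) (midOf L5 a5)
            (compileTerm mag t)) default).2 * I)‖ ≤
      (compileTerm mag t).rc * (S0 + c.epsT) *
          ((Hn (hOf c L2) (hOf c L3) (hOf c L5) (compileTerm mag t) : ℝ) / S0) ^ 2 +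
        (compileTerm mag t).dr * (S0 + c.epsT) + (compileTerm mag t).rhi * c.epsT := by
  set ct := compileTerm mag t with hct
  set e := c.cosT.getD (idx (midOf L2 a2) (midOf L3 a3) (midOf L5 a5) ct) default with he
  obtain ⟨hrc, hrhi, hrc0, ha, hb, hcc⟩ := compileTerm_spec hm h1 h28 hσ1 hσ2
  rw [← hct] at hrc hrhi hrc0 ha hb hcc
  -- the phases
  set φ : ℝ := t.a * θ₂ + t.b * θ₃ + t.c * θ₅ with hφ
  set φ₀ : ℝ := t.a * thetaC L2 a2 + t.b * thetaC L3 a3 + t.c * thetaC L5 a5 with hφ₀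
  set δ : ℝ := φ - φ₀ with hδ
  have hδ' : (δ : ℂ) = (t.a : ℂ) * ↑(θ₂ - thetaC L2 a2) + (t.b : ℂ) * ↑(θ₃ - thetaC L3 a3) +
      (t.c : ℂ) * ↑(θ₅ - thetaC L5 a5) := by
    rw [hδ, hφ, hφ₀]; push_cast; ring
  -- the unreduced index and the centre phase
  set mU : ℕ := t.a * midOf L2 a2 + t.b * midOf L3 a3 + t.c * midOf L5 a5 with hmU
  have hidx : idx (midOf L2 a2) (midOf L3 a3) (midOf L5 a5) ct = mU % 16384 := by
    rw [idx, ha, hb, hcc]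
  have hφ₀' : 2 * Real.pi * (mU : ℝ) / 16384 = φ₀ := by
    rw [hφ₀, ← midOf_angle hL2, ← midOf_angle hL3, ← midOf_angle hL5, hmU]
    push_cast; ring
  set w₀ : ℂ := cexp (↑φ₀ * I) with hw₀
  have hw₀n : ‖w₀‖ = 1 := norm_exp_ofReal_mul_I _
  -- the table
  have hCt : ‖(S0 : ℂ) * w₀ - gz e.1 e.2‖ ≤ c.epsT := by
    have hlt : mU % 16384 < 16384 := Nat.mod_lt _ (by norm_num)
    have := hc.cos (mU % 16384) hlt
    rw [cexp_mod mU] at this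
    have hw : cexp (↑(2 * Real.pi * ↑mU / 16384) * I) = w₀ := by
      rw [hw₀, ← hφ₀']
    rw [hw] at this
    rw [he, hidx, gz]
    exact this
  -- the value of the term
  have hval : t.mono (zOf 2 σ θ₂) (zOf 3 σ θ₃) (zOf 5 σ θ₅) =
      (((t.smooth : ℕ) : ℝ) ^ (-σ) : ℝ) * (w₀ * cexp (δ * I)) := by
    rw [mono_zOf, hw₀, ← Complex.exp_add, ← hφ, hδ]
    congr 1; push_cast; ring
  -- the half-width
  have hδS : |δ| * S0 ≤ (Hn (hOf c L2) (hOf c L3) (hOf c L5) ct : ℝ) := by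
    have e2 := abs_sub_thetaC_le h2l h2u
    have e3 := abs_sub_thetaC_le h3l h3u
    have e5 := abs_sub_thetaC_le h5l h5u
    have g2 := hOf_ge hc L2
    have g3 := hOf_ge hc L3
    have g5 := hOf_ge hc L5
    have hδeq : δ = t.a * (θ₂ - thetaC L2 a2) + t.b * (θ₃ - thetaC L3 a3) +
        t.c * (θ₅ - thetaC L5 a5) := by rw [hδ, hφ, hφ₀]; ring
    have habs : |δ| ≤ t.a * (Real.pi / 2 ^ L2) + t.b * (Real.pi / 2 ^ L3) +
        t.c * (Real.pi / 2 ^ L5) := by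
      rw [hδeq]
      refine (abs_add_le _ _).trans (add_le_add ((abs_add_le _ _).trans (add_le_add ?_ ?_)) ?_)
      · rw [abs_mul, Nat.abs_cast]; exact mul_le_mul_of_nonneg_left e2 (Nat.cast_nonneg _)
      · rw [abs_mul, Nat.abs_cast]; exact mul_le_mul_of_nonneg_left e3 (Nat.cast_nonneg _)
      · rw [abs_mul, Nat.abs_cast]; exact mul_le_mul_of_nonneg_left e5 (Nat.cast_nonneg _)
    rw [Hn, ha, hb, hcc]
    push_cast
    have hS : (0 : ℝ) < S0 := by exact_mod_cast S0_pos
    have k2 : Real.pi / 2 ^ L2 * S0 ≤ hOf c L2 := by rw [div_mul_eq_mul_div]; exact g2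
    have k3 : Real.pi / 2 ^ L3 * S0 ≤ hOf c L3 := by rw [div_mul_eq_mul_div]; exact g3
    have k5 : Real.pi / 2 ^ L5 * S0 ≤ hOf c L5 := by rw [div_mul_eq_mul_div]; exact g5
    have ha0 := Nat.cast_nonneg (α := ℝ) t.a
    have hb0 := Nat.cast_nonneg (α := ℝ) t.b
    have hc0 := Nat.cast_nonneg (α := ℝ) t.c
    calc |δ| * S0 ≤ (t.a * (Real.pi / 2 ^ L2) + t.b * (Real.pi / 2 ^ L3) +
          t.c * (Real.pi / 2 ^ L5)) * S0 := mul_le_mul_of_nonneg_right habs hS.le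
      _ = t.a * (Real.pi / 2 ^ L2 * S0) + t.b * (Real.pi / 2 ^ L3 * S0) +
          t.c * (Real.pi / 2 ^ L5 * S0) := by ring
      _ ≤ t.a * (hOf c L2 : ℝ) + t.b * (hOf c L3 : ℝ) + t.c * (hOf c L5 : ℝ) := by
          gcongr
  have hHS : (Hn (hOf c L2) (hOf c L3) (hOf c L5) ct : ℝ) ≤ S0 := by exact_mod_cast hH
  have hmain := term_decomp (S := (S0 : ℝ)) (ε := (c.epsT : ℝ)) (by exact_mod_cast S0_pos)
    (Real.rpow_nonneg (Nat.cast_nonneg _) _) hrc hrhi hrc0 hw₀n hCt hδS hHS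
  rw [hval, ← hδ']
  exact_mod_cast hmain

include hc hm hL2 hL3 hL5 hσ1 hσ2 h2l h2u h3l h3u h5l h5u in
/-- **The group enclosure.** For a list of terms of `ζ_N` accumulated from `g₀` on the box, if the
final flag is set: `S² Σ_t mono_t(z) = ΔU + δθ₂ ΔV₂ + δθ₃ ΔV₃ + δθ₅ ΔV₅ + E` with
`|E| ≤ Δdr (S + ε) + Δrh ε + Δt (S + ε)/S²` (`Δ` = final minus initial accumulator).
[cite: PlattTrudgian2016, §2.2] -/
theorem group_enclosure :
    ∀ (ts : List Term) (g₀ : GAcc), (∀ t ∈ ts, 1 ≤ t.smooth ∧ t.smooth ≤ 28) →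
      (accTerms c (midOf L2 a2) (midOf L3 a3) (midOf L5 a5) (hOf c L2) (hOf c L3) (hOf c L5)
        (ts.map (compileTerm mag)) g₀).ok = true →
      ∃ E : ℂ, (S0 : ℂ) ^ 2 * (ts.map fun t ↦ t.mono (zOf 2 σ θ₂) (zOf 3 σ θ₃) (zOf 5 σ θ₅)).sum =
        gz ((accTerms c (midOf L2 a2) (midOf L3 a3) (midOf L5 a5) (hOf c L2) (hOf c L3) (hOf c L5)
              (ts.map (compileTerm mag)) g₀).ux - g₀.ux)
           ((accTerms c (midOf L2 a2) (midOf L3 a3) (midOf L5 a5) (hOf c L2) (hOf c L3) (hOf c L5)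
              (ts.map (compileTerm mag)) g₀).uy - g₀.uy) +
        ↑(θ₂ - thetaC L2 a2) *
          gz ((accTerms c (midOf L2 a2) (midOf L3 a3) (midOf L5 a5) (hOf c L2) (hOf c L3) (hOf c L5)
              (ts.map (compileTerm mag)) g₀).v2x - g₀.v2x)
             ((accTerms c (midOf L2 a2) (midOf L3 a3) (midOf L5 a5) (hOf c L2) (hOf c L3) (hOf c L5)
              (ts.map (compileTerm mag)) g₀).v2y - g₀.v2y) +
        ↑(θ₃ - thetaC L3 a3) *
          gz ((accTerms c (midOf L2 a2) (midOf L3 a3) (midOf L5 a5) (hOf c L2) (hOf c L3) (hOf c L5)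
              (ts.map (compileTerm mag)) g₀).v3x - g₀.v3x)
             ((accTerms c (midOf L2 a2) (midOf L3 a3) (midOf L5 a5) (hOf c L2) (hOf c L3) (hOf c L5)
              (ts.map (compileTerm mag)) g₀).v3y - g₀.v3y) +
        ↑(θ₅ - thetaC L5 a5) *
          gz ((accTerms c (midOf L2 a2) (midOf L3 a3) (midOf L5 a5) (hOf c L2) (hOf c L3) (hOf c L5)
              (ts.map (compileTerm mag)) g₀).v5x - g₀.v5x)
             ((accTerms c (midOf L2 a2) (midOf L3 a3) (midOf L5 a5) (hOf c L2) (hOf c L3) (hOf c L5)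
              (ts.map (compileTerm mag)) g₀).v5y - g₀.v5y) + E ∧
        ‖E‖ ≤ ((accTerms c (midOf L2 a2) (midOf L3 a3) (midOf L5 a5) (hOf c L2) (hOf c L3) (hOf c L5)
              (ts.map (compileTerm mag)) g₀).dr - g₀.dr) * (S0 + c.epsT) +
          ((accTerms c (midOf L2 a2) (midOf L3 a3) (midOf L5 a5) (hOf c L2) (hOf c L3) (hOf c L5)
              (ts.map (compileTerm mag)) g₀).rh - g₀.rh) * c.epsT +
          ((accTerms c (midOf L2 a2) (midOf L3 a3) (midOf L5 a5) (hOf c L2) (hOf c L3) (hOf c L5)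
              (ts.map (compileTerm mag)) g₀).t - g₀.t) * (S0 + c.epsT) / (S0 : ℝ) ^ 2
  | [], g₀, _, _ => ⟨0, by simp [accTerms, gz], by simp [accTerms]⟩
  | t :: ts, g₀, hts, hok => by
    have hstep : accTerms c (midOf L2 a2) (midOf L3 a3) (midOf L5 a5) (hOf c L2) (hOf c L3)
        (hOf c L5) ((t :: ts).map (compileTerm mag)) g₀ =
        accTerms c (midOf L2 a2) (midOf L3 a3) (midOf L5 a5) (hOf c L2) (hOf c L3) (hOf c L5)
          (ts.map (compileTerm mag)) (accTerm c (midOf L2 a2) (midOf L3 a3) (midOf L5 a5) (hOf c L2)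
          (hOf c L3) (hOf c L5) g₀ (compileTerm mag t)) := rfl
    rw [hstep] at hok ⊢
    -- the flag of the head term
    have hok₁ := accTerms_ok _ _ hok
    have hH : Hn (hOf c L2) (hOf c L3) (hOf c L5) (compileTerm mag t) ≤ 268435456 := by
      rw [accTerm_eq] at hok₁
      simp only [Bool.and_eq_true, decide_eq_true_eq] at hok₁
      exact hok₁.2
    -- induction hypothesis and the head term
    obtain ⟨E', hE', hB'⟩ := group_enclosure ts _ (fun t' ht' ↦ hts t' (List.mem_cons_of_mem _ ht'))
      hok
    obtain ⟨h1, h28⟩ := hts t List.mem_cons_self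
    have hdec := cterm_decomp hc hm hL2 hL3 hL5 hσ1 hσ2 h2l h2u h3l h3u h5l h5u h1 h28 hH
    -- names
    set m2 := midOf L2 a2
    set m3 := midOf L3 a3
    set m5 := midOf L5 a5
    set h2 := hOf c L2
    set h3 := hOf c L3
    set h5 := hOf c L5
    set ct := compileTerm mag t with hct
    set g₁ := accTerm c m2 m3 m5 h2 h3 h5 g₀ ct with hg₁
    set g := accTerms c m2 m3 m5 h2 h3 h5 (ts.map (compileTerm mag)) g₁ with hg
    set e := c.cosT.getD (idx m2 m3 m5 ct) default with he
    set Et : ℂ := (S0 : ℂ) ^ 2 * t.mono (zOf 2 σ θ₂) (zOf 3 σ θ₃) (zOf 5 σ θ₅) -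
        ct.rc * gz e.1 e.2 -
        ((t.a : ℂ) * ↑(θ₂ - thetaC L2 a2) + (t.b : ℂ) * ↑(θ₃ - thetaC L3 a3) +
          (t.c : ℂ) * ↑(θ₅ - thetaC L5 a5)) * (ct.rc * gz e.1 e.2 * I) with hEt
    have ht : (S0 : ℂ) ^ 2 * t.mono (zOf 2 σ θ₂) (zOf 3 σ θ₃) (zOf 5 σ θ₅) =
        ct.rc * gz e.1 e.2 + ((t.a : ℂ) * ↑(θ₂ - thetaC L2 a2) + (t.b : ℂ) * ↑(θ₃ - thetaC L3 a3) +
          (t.c : ℂ) * ↑(θ₅ - thetaC L5 a5)) * (ct.rc * gz e.1 e.2 * I) + Et := by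
      rw [hEt]; ring
    have key := step_identity ht hE'
    -- the fields of `g₁`
    have fa : ct.a = t.a := rfl
    have fb : ct.b = t.b := rfl
    have fc : ct.c = t.c := rfl
    have fux : g₁.ux = g₀.ux + ct.rc * e.1 := rfl
    have fuy : g₁.uy = g₀.uy + ct.rc * e.2 := rfl
    have f2x : g₁.v2x = g₀.v2x - ct.a * (ct.rc * e.2) := rfl
    have f2y : g₁.v2y = g₀.v2y + ct.a * (ct.rc * e.1) := rfl
    have f3x : g₁.v3x = g₀.v3x - ct.b * (ct.rc * e.2) := rfl
    have f3y : g₁.v3y = g₀.v3y + ct.b * (ct.rc * e.1) := rfl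
    have f5x : g₁.v5x = g₀.v5x - ct.c * (ct.rc * e.2) := rfl
    have f5y : g₁.v5y = g₀.v5y + ct.c * (ct.rc * e.1) := rfl
    have ft : g₁.t = g₀.t + ct.rc * ((Hn h2 h3 h5 ct : ℤ) * (Hn h2 h3 h5 ct : ℤ)) := rfl
    have fdr : g₁.dr = g₀.dr + ct.dr := rfl
    have frh : g₁.rh = g₀.rh + ct.rhi := rfl
    refine ⟨Et + E', ?_, ?_⟩
    · rw [List.map_cons, List.sum_cons, key]
      have e1 : g.ux - g₀.ux = ct.rc * e.1 + (g.ux - g₁.ux) := by rw [fux]; ring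
      have e2 : g.uy - g₀.uy = ct.rc * e.2 + (g.uy - g₁.uy) := by rw [fuy]; ring
      have e3 : g.v2x - g₀.v2x = -(t.a * (ct.rc * e.2)) + (g.v2x - g₁.v2x) := by rw [f2x, fa]; ring
      have e4 : g.v2y - g₀.v2y = t.a * (ct.rc * e.1) + (g.v2y - g₁.v2y) := by rw [f2y, fa]; ring
      have e5 : g.v3x - g₀.v3x = -(t.b * (ct.rc * e.2)) + (g.v3x - g₁.v3x) := by rw [f3x, fb]; ring
      have e6 : g.v3y - g₀.v3y = t.b * (ct.rc * e.1) + (g.v3y - g₁.v3y) := by rw [f3y, fb]; ring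
      have e7 : g.v5x - g₀.v5x = -(t.c * (ct.rc * e.2)) + (g.v5x - g₁.v5x) := by rw [f5x, fc]; ring
      have e8 : g.v5y - g₀.v5y = t.c * (ct.rc * e.1) + (g.v5y - g₁.v5y) := by rw [f5y, fc]; ring
      rw [e1, e2, e3, e4, e5, e6, e7, e8]
      simp only [gz_add, gz_rot, gz_smul]
      push_cast
      ring
    · have hS : (0 : ℝ) < S0 := by exact_mod_cast S0_pos
      calc ‖Et + E'‖ ≤ ‖Et‖ + ‖E'‖ := norm_add_le _ _
        _ ≤ _ := add_le_add hdec hB'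
        _ = _ := by
          rw [fdr, frh, ft]
          push_cast
          field_simp
          ring

end Group


/-! ## Gaussian integers: norms, square roots, projections -/

/-- `|gz x y|² = x² + y²`. [folklore] -/
theorem norm_gz_sq (x y : ℤ) : ‖gz x y‖ ^ 2 = ((x * x + y * y : ℤ) : ℝ) := by
  rw [gz, Complex.sq_norm, Complex.normSq_apply]
  push_cast
  simp

/-- `⌊√(x²+y²)⌋ ≤ |gz x y| ≤ ⌈√(x²+y²)⌉` (integer square roots). [folklore] -/
theorem sqrt_bounds_gz (x y : ℤ) :
    (Nat.sqrt (x * x + y * y).toNat : ℝ) ≤ ‖gz x y‖ ∧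
      ‖gz x y‖ ≤ (sqrtCeil (x * x + y * y).toNat : ℝ) := by
  have hnn : (0 : ℤ) ≤ x * x + y * y := by nlinarith
  have hk : (((x * x + y * y).toNat : ℕ) : ℝ) = ((x * x + y * y : ℤ) : ℝ) := by
    exact_mod_cast Int.toNat_of_nonneg hnn
  have hsq := norm_gz_sq x y
  constructor
  · refine le_of_sq_le_sq ?_ (norm_nonneg _)
    rw [hsq, ← hk]
    exact_mod_cast Nat.sqrt_le' _
  · refine le_of_sq_le_sq ?_ (Nat.cast_nonneg _)
    rw [hsq, ← hk]
    exact_mod_cast le_sqrtCeil_sq _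

/-- `Re(conj (gz ux uy) · gz vx vy) = ux vx + uy vy`. [folklore] -/
theorem re_conj_gz_mul (ux uy vx vy : ℤ) :
    (conj (gz ux uy) * gz vx vy).re = ((ux * vx + uy * vy : ℤ) : ℝ) := by
  simp [gz, Complex.mul_re]

/-! ## The two modulus bounds -/

/-- **Lower bound by projection**: `|U + L + E| ≥ |U| + Re(Ū L)/|U| − R` for `U ≠ 0`, `|E| ≤ R`.
[folklore] -/
theorem norm_add_add_ge {U L E : ℂ} {R : ℝ} (hU : U ≠ 0) (hE : ‖E‖ ≤ R) :
    ‖U‖ + (conj U * L).re / ‖U‖ - R ≤ ‖U + L + E‖ := by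
  have hu : 0 < ‖U‖ := norm_pos_iff.2 hU
  have h1 : (conj U * (U + L + E)).re ≤ ‖U‖ * ‖U + L + E‖ := by
    calc (conj U * (U + L + E)).re ≤ ‖conj U * (U + L + E)‖ := Complex.re_le_norm _
      _ = ‖U‖ * ‖U + L + E‖ := by rw [norm_mul, Complex.norm_conj]
  have h2 : (conj U * (U + L + E)).re = ‖U‖ ^ 2 + (conj U * L).re + (conj U * E).re := by
    rw [mul_add, mul_add, add_re, add_re, Complex.conj_mul', ← ofReal_pow, ofReal_re]
  have h3 : -(‖U‖ * R) ≤ (conj U * E).re := by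
    have := Complex.abs_re_le_norm (conj U * E)
    rw [norm_mul, Complex.norm_conj] at this
    have h4 : ‖U‖ * ‖E‖ ≤ ‖U‖ * R := mul_le_mul_of_nonneg_left hE hu.le
    linarith [neg_abs_le (conj U * E).re]
  have key : ‖U‖ ^ 2 + (conj U * L).re ≤ ‖U‖ * (‖U + L + E‖ + R) := by linarith
  have : ‖U‖ + (conj U * L).re / ‖U‖ ≤ ‖U + L + E‖ + R := by
    rw [show ‖U‖ + (conj U * L).re / ‖U‖ = (‖U‖ ^ 2 + (conj U * L).re) / ‖U‖ by
      field_simp]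
    rw [div_le_iff₀ hu]
    linarith
  linarith

/-- `|U + L|² = |U|² + 2 Re(Ū L) + |L|²`. [folklore] -/
theorem norm_add_sq_eq (U L : ℂ) : ‖U + L‖ ^ 2 = ‖U‖ ^ 2 + 2 * (conj U * L).re + ‖L‖ ^ 2 := by
  rw [Complex.sq_norm, Complex.sq_norm, Complex.sq_norm, Complex.normSq_add]
  have : (U * conj L).re = (conj U * L).re := by
    rw [← Complex.conj_re (U * conj L), map_mul, Complex.conj_conj, mul_comm]
  rw [this]
  ring

/-- **Upper bound by projection**: `|U + L + E| ≤ |U| + Re(Ū L)/|U| + |L|²/(2|U|) + R` for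
`U ≠ 0`, `|E| ≤ R`. [folklore] -/
theorem norm_add_add_le' {U L E : ℂ} {R : ℝ} (hU : U ≠ 0) (hE : ‖E‖ ≤ R) :
    ‖U + L + E‖ ≤ ‖U‖ + (conj U * L).re / ‖U‖ + ‖L‖ ^ 2 / (2 * ‖U‖) + R := by
  have hu : 0 < ‖U‖ := norm_pos_iff.2 hU
  set r := ‖U‖ with hr
  set a := (conj U * L).re / r with ha
  set q := ‖L‖ ^ 2 / (2 * r) with hq
  have hUL : ‖U + L‖ ≤ r + a + q := by
    refine le_of_sq_le_sq ?_ ?_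
    · rw [norm_add_sq_eq, ← hr]
      have e1 : 2 * (conj U * L).re = 2 * r * a := by rw [ha]; field_simp
      have e2 : ‖L‖ ^ 2 = 2 * r * q := by rw [hq]; field_simp
      nlinarith [sq_nonneg (a + q)]
    · -- `r + a + q = ((r + a)² + r² + (|L|² − a²))/(2r) ≥ 0`
      have hal : a ^ 2 ≤ ‖L‖ ^ 2 := by
        have h1 : |(conj U * L).re| ≤ r * ‖L‖ := by
          calc |(conj U * L).re| ≤ ‖conj U * L‖ := Complex.abs_re_le_norm _
            _ = r * ‖L‖ := by rw [norm_mul, Complex.norm_conj]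
        have h2 : |a| ≤ ‖L‖ := by
          rw [ha, abs_div, abs_of_pos hu, div_le_iff₀ hu]; linarith
        calc a ^ 2 = |a| ^ 2 := (sq_abs a).symm
          _ ≤ ‖L‖ ^ 2 := pow_le_pow_left₀ (abs_nonneg a) h2 2
      have e2 : ‖L‖ ^ 2 = 2 * r * q := by rw [hq]; field_simp
      nlinarith [sq_nonneg (r + a)]
  calc ‖U + L + E‖ ≤ ‖U + L‖ + ‖E‖ := norm_add_le _ _
    _ ≤ r + a + q + R := add_le_add hUL hE

/-! ## Rational enclosures of `A/|U|` -/

/-- Division of a nonpositive number is monotone in the (positive) denominator. [folklore] -/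
theorem div_le_div_of_nonpos_left {a b c : ℝ} (ha : a ≤ 0) (hc : 0 < c) (h : c ≤ b) :
    a / c ≤ a / b := by
  have := div_le_div_of_nonneg_left (neg_nonneg.2 ha) hc h
  rw [neg_div, neg_div, neg_le_neg_iff] at this
  exact this

/-- `loQ A sm sp ≤ A/u ≤ hiQ A sm sp` for `0 < sm ≤ u ≤ sp`. [folklore] -/
theorem loQ_le_le_hiQ (A : ℤ) {sm sp : ℕ} {u : ℝ} (hsm : 0 < sm) (h1 : (sm : ℝ) ≤ u)
    (h2 : u ≤ sp) : (loQ A sm sp : ℝ) ≤ A / u ∧ (A : ℝ) / u ≤ hiQ A sm sp := by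
  have hsmr : (0 : ℝ) < sm := by exact_mod_cast hsm
  have hu : 0 < u := lt_of_lt_of_le hsmr h1
  have hsp : (0 : ℝ) < sp := lt_of_lt_of_le hu h2
  have hsmz : (0 : ℤ) < (sm : ℤ) := by exact_mod_cast hsm
  have hspz : (0 : ℤ) < (sp : ℤ) := by exact_mod_cast (show 0 < sp by exact_mod_cast hsp)
  unfold loQ hiQ cdivZ
  by_cases hA : 0 ≤ A
  · have hAr : (0 : ℝ) ≤ A := by exact_mod_cast hA
    rw [if_pos hA, if_pos hA]
    constructor
    · calc ((A / (sp : ℤ) : ℤ) : ℝ) ≤ (A : ℝ) / ((sp : ℤ) : ℝ) := Numerics.fdiv_le_div hspz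
        _ = A / sp := by norm_cast
        _ ≤ A / u := div_le_div_of_nonneg_left hAr hu h2
    · calc (A : ℝ) / u ≤ A / sm := div_le_div_of_nonneg_left hAr hsmr h1
        _ = (A : ℝ) / ((sm : ℤ) : ℝ) := by norm_cast
        _ ≤ (Numerics.cdiv A sm : ℝ) := Numerics.div_le_cdiv hsmz
  · have hAr : (A : ℝ) ≤ 0 := by exact_mod_cast (le_of_lt (not_le.1 hA))
    rw [if_neg hA, if_neg hA]
    constructor
    · calc ((A / (sm : ℤ) : ℤ) : ℝ) ≤ (A : ℝ) / ((sm : ℤ) : ℝ) := Numerics.fdiv_le_div hsmz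
        _ = A / sm := by norm_cast
        _ ≤ A / u := div_le_div_of_nonpos_left hAr hsmr h1
    · calc (A : ℝ) / u ≤ A / sp := div_le_div_of_nonpos_left hAr hu h2
        _ = (A : ℝ) / ((sp : ℤ) : ℝ) := by norm_cast
        _ ≤ (Numerics.cdiv A sp : ℝ) := Numerics.div_le_cdiv hspz

/-! ## Summaries of a group -/

/-- `U = ux + i uy` of an accumulator. [folklore] -/
def Uof (g : GAcc) : ℂ := gz g.ux g.uy

/-- The linear part `δ₂ V₂ + δ₃ V₃ + δ₅ V₅` of an accumulator. [folklore] -/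
def Lof (g : GAcc) (d2 d3 d5 : ℝ) : ℂ :=
  (d2 : ℂ) * gz g.v2x g.v2y + (d3 : ℂ) * gz g.v3x g.v3y + (d5 : ℂ) * gz g.v5x g.v5y

/-- `sm ≤ |U| ≤ sp`. [folklore] -/
theorem sm_le_norm_le_sp (c : Ctx) (g : GAcc) :
    ((summarize c g).sm : ℝ) ≤ ‖Uof g‖ ∧ ‖Uof g‖ ≤ ((summarize c g).sp : ℝ) :=
  sqrt_bounds_gz g.ux g.uy

/-- `Re(Ū L) = δ₂ A₂ + δ₃ A₃ + δ₅ A₅`. [folklore] -/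
theorem re_conj_U_L (c : Ctx) (g : GAcc) (d2 d3 d5 : ℝ) :
    (conj (Uof g) * Lof g d2 d3 d5).re =
      d2 * (summarize c g).A2 + d3 * (summarize c g).A3 + d5 * (summarize c g).A5 := by
  have h2 := re_conj_gz_mul g.ux g.uy g.v2x g.v2y
  have h3 := re_conj_gz_mul g.ux g.uy g.v3x g.v3y
  have h5 := re_conj_gz_mul g.ux g.uy g.v5x g.v5y
  have e : conj (Uof g) * Lof g d2 d3 d5 = (d2 : ℂ) * (conj (gz g.ux g.uy) * gz g.v2x g.v2y) +
      (d3 : ℂ) * (conj (gz g.ux g.uy) * gz g.v3x g.v3y) +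
      (d5 : ℂ) * (conj (gz g.ux g.uy) * gz g.v5x g.v5y) := by
    rw [Uof, Lof]; ring
  rw [e, add_re, add_re, re_ofReal_mul, re_ofReal_mul, re_ofReal_mul, h2, h3, h5]
  simp [summarize]

/-- `|L| ≤ (h₂ W₂ + h₃ W₃ + h₅ W₅)/S` when `|δ_p| S ≤ h_p`. [folklore] -/
theorem norm_L_le (c : Ctx) (g : GAcc) {d2 d3 d5 : ℝ} {h2 h3 h5 : ℕ} (e2 : |d2| * S0 ≤ h2)
    (e3 : |d3| * S0 ≤ h3) (e5 : |d5| * S0 ≤ h5) :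
    ‖Lof g d2 d3 d5‖ * S0 ≤
      (h2 : ℝ) * (summarize c g).W2 + (h3 : ℝ) * (summarize c g).W3 + (h5 : ℝ) * (summarize c g).W5 := by
  have w2 := (sqrt_bounds_gz g.v2x g.v2y).2
  have w3 := (sqrt_bounds_gz g.v3x g.v3y).2
  have w5 := (sqrt_bounds_gz g.v5x g.v5y).2
  have hS : (0 : ℝ) ≤ S0 := Nat.cast_nonneg _
  have n2 : ‖(d2 : ℂ) * gz g.v2x g.v2y‖ * S0 ≤ h2 * (summarize c g).W2 := by
    rw [norm_mul, Complex.norm_real, Real.norm_eq_abs, show |d2| * ‖gz g.v2x g.v2y‖ * S0 =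
      (|d2| * S0) * ‖gz g.v2x g.v2y‖ by ring]
    exact mul_le_mul e2 w2 (norm_nonneg _) (Nat.cast_nonneg _)
  have n3 : ‖(d3 : ℂ) * gz g.v3x g.v3y‖ * S0 ≤ h3 * (summarize c g).W3 := by
    rw [norm_mul, Complex.norm_real, Real.norm_eq_abs, show |d3| * ‖gz g.v3x g.v3y‖ * S0 =
      (|d3| * S0) * ‖gz g.v3x g.v3y‖ by ring]
    exact mul_le_mul e3 w3 (norm_nonneg _) (Nat.cast_nonneg _)
  have n5 : ‖(d5 : ℂ) * gz g.v5x g.v5y‖ * S0 ≤ h5 * (summarize c g).W5 := by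
    rw [norm_mul, Complex.norm_real, Real.norm_eq_abs, show |d5| * ‖gz g.v5x g.v5y‖ * S0 =
      (|d5| * S0) * ‖gz g.v5x g.v5y‖ by ring]
    exact mul_le_mul e5 w5 (norm_nonneg _) (Nat.cast_nonneg _)
  have := norm_add₃_le (a := (d2 : ℂ) * gz g.v2x g.v2y) (b := (d3 : ℂ) * gz g.v3x g.v3y)
    (c := (d5 : ℂ) * gz g.v5x g.v5y)
  rw [Lof]
  nlinarith

/-- The second-order radius dominates the bound of the group enclosure. [folklore] -/
theorem R2_ge (c : Ctx) (g : GAcc) :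
    (g.dr : ℝ) * (S0 + c.epsT) + g.rh * c.epsT + g.t * (S0 + c.epsT) / (S0 : ℝ) ^ 2 ≤
      ((summarize c g).R2 : ℝ) := by
  have h := Numerics.div_le_cdiv (a := g.t * (268435456 + c.epsT)) (b := 268435456 * 268435456)
    (by norm_num)
  simp only [summarize, cdivZ]
  push_cast at h ⊢
  have hS : (S0 : ℝ) = 268435456 := by norm_num [S0]
  rw [hS]
  have : (g.t : ℝ) * (268435456 + c.epsT) / (268435456 : ℝ) ^ 2 =
      (g.t : ℝ) * (268435456 + c.epsT) / (268435456 * 268435456) := by norm_num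
  rw [this]
  linarith

/-! ## Soundness of the box evaluation -/

/-- The terms of the group `q`. [folklore] -/
def Tq (N q : ℕ) : List Term := (terms N).filter fun t ↦ t.q = q

/-- The compiled terms of the group `q`. [folklore] -/
def ctsOf (mag : Array (ℕ × ℕ × ℕ × ℕ)) (N q : ℕ) : List CTerm := (Tq N q).map (compileTerm mag)

/-- The compiled weight `≥ S q^{-σ}` of the group `q`. [folklore] -/
def wOf (mag : Array (ℕ × ℕ × ℕ × ℕ)) (q : ℕ) : ℤ := ((mag.getD q default).2.1 : ℤ)

/-- The accumulator of the group `q` on the box. [folklore] -/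
def gOf (c : Ctx) (mag : Array (ℕ × ℕ × ℕ × ℕ)) (N q L2 L3 L5 a2 a3 a5 : ℕ) : GAcc :=
  accTerms c (midOf L2 a2) (midOf L3 a3) (midOf L5 a5) (hOf c L2) (hOf c L3) (hOf c L5)
    (ctsOf mag N q) GAcc.zero

/-- The scaled deviation `u = S (θ − θ⁰)` from the centre angle. [folklore] -/
noncomputable def uOf (L a : ℕ) (θ : ℝ) : ℝ := S0 * (θ - thetaC L a)

/-- `Γ_q = S² |G_{N,q}(z(σ, θ))|`. [folklore] -/
noncomputable def Gam (N q : ℕ) (σ θ₂ θ₃ θ₅ : ℝ) : ℝ :=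
  (S0 : ℝ) ^ 2 * ‖G N q (zOf 2 σ θ₂) (zOf 3 σ θ₃) (zOf 5 σ θ₅)‖

/-- The invariant of the fold over the non-unit groups: some point `c_p ∈ [clo_p, chi_p]` with
`total + Σ_p u_p c_p ≤ X`. [folklore] -/
def Inv (e : EState) (u₂ u₃ u₅ X : ℝ) : Prop :=
  ∃ c₂ c₃ c₅ : ℝ, (e.clo2 : ℝ) ≤ c₂ ∧ c₂ ≤ e.chi2 ∧ (e.clo3 : ℝ) ≤ c₃ ∧ c₃ ≤ e.chi3 ∧
    (e.clo5 : ℝ) ≤ c₅ ∧ c₅ ≤ e.chi5 ∧ (e.total : ℝ) + u₂ * c₂ + u₃ * c₃ + u₅ * c₅ ≤ X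

/-- `compileGroups` of `groupsOf`: head `q = 1`, then the groups of `qs N ∖ {1}`. [folklore] -/
theorem compileGroups_groupsOf {N : ℕ} (hN1 : 1 ≤ N) (mag : Array (ℕ × ℕ × ℕ × ℕ)) :
    compileGroups mag (groupsOf N) = (wOf mag 1, ctsOf mag N 1) ::
      (((qs N).filter fun q ↦ q ≠ 1).map fun q ↦ (wOf mag q, ctsOf mag N q)) := by
  rw [groupsOf, compileGroups, List.map_map]
  conv_lhs => rw [qs_eq_cons hN1]
  rfl

/-- The flag of the fold is monotone, and records the flag of each group. [folklore] -/
theorem stepGroups_ok {c : Ctx} {m2 m3 m5 h2 h3 h5 : ℕ} :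
    ∀ (gs : List (ℤ × List CTerm)) (e : EState),
      (stepGroups c m2 m3 m5 h2 h3 h5 gs e).ok = true →
        e.ok = true ∧ ∀ g ∈ gs, (groupSum c m2 m3 m5 h2 h3 h5 g.2).ok = true
  | [], e, h => ⟨h, fun g hg ↦ by simp at hg⟩
  | g :: gs, e, h => by
    obtain ⟨h1, h2'⟩ := stepGroups_ok gs _ h
    have hsplit : e.ok = true ∧ (groupSum c m2 m3 m5 h2 h3 h5 g.2).ok = true := by
      unfold stepGroup at h1
      split_ifs at h1 <;> simpa [Bool.and_eq_true] using h1
    exact ⟨hsplit.1, fun g' hg' ↦ by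
      rcases List.mem_cons.1 hg' with rfl | h'
      · exact hsplit.2
      · exact h2' g' h'⟩

section Eval

variable {c : Ctx} (hc : c.Valid) {ls js : ℕ} {mag : Array (ℕ × ℕ × ℕ × ℕ)}
  (hm : MagValid ls js mag) {N : ℕ} (hN1 : 1 ≤ N) (hN : N ≤ 28)
  {L2 L3 L5 a2 a3 a5 : ℕ} (hL2 : L2 ≤ 13) (hL3 : L3 ≤ 13) (hL5 : L5 ≤ 13)
  {σ θ₂ θ₃ θ₅ : ℝ} (hσ1 : sigLo ls js ≤ σ) (hσ2 : σ ≤ sigHi ls js)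
  (h2l : 2 * Real.pi * a2 / 2 ^ L2 ≤ θ₂) (h2u : θ₂ ≤ 2 * Real.pi * (a2 + 1) / 2 ^ L2)
  (h3l : 2 * Real.pi * a3 / 2 ^ L3 ≤ θ₃) (h3u : θ₃ ≤ 2 * Real.pi * (a3 + 1) / 2 ^ L3)
  (h5l : 2 * Real.pi * a5 / 2 ^ L5 ≤ θ₅) (h5u : θ₅ ≤ 2 * Real.pi * (a5 + 1) / 2 ^ L5)

include hc in
/-- `|θ_p − θ⁰_p| S ≤ h_p` on the box. [folklore] -/
theorem abs_sub_mul_le {L a : ℕ} {θ : ℝ} (hl : 2 * Real.pi * a / 2 ^ L ≤ θ)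
    (hu : θ ≤ 2 * Real.pi * (a + 1) / 2 ^ L) : |θ - thetaC L a| * S0 ≤ (hOf c L : ℝ) := by
  have h1 := abs_sub_thetaC_le hl hu
  have h2 := hOf_ge hc L
  calc |θ - thetaC L a| * S0 ≤ (Real.pi / 2 ^ L) * S0 :=
      mul_le_mul_of_nonneg_right h1 (Nat.cast_nonneg _)
    _ = Real.pi * S0 / 2 ^ L := by ring
    _ ≤ hOf c L := h2

include hc in
/-- `|u_p| ≤ h_p` on the box. [folklore] -/
theorem abs_uOf_le {L a : ℕ} {θ : ℝ} (hl : 2 * Real.pi * a / 2 ^ L ≤ θ)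
    (hu : θ ≤ 2 * Real.pi * (a + 1) / 2 ^ L) : |uOf L a θ| ≤ (hOf c L : ℝ) := by
  rw [uOf, abs_mul, Nat.abs_cast, mul_comm]
  exact abs_sub_mul_le hc hl hu

include hm hN hσ1 in
/-- The compiled weight dominates `S q^{-σ}` for `q ∈ qs N`. [folklore] -/
theorem w_ge {q : ℕ} (hq : q ∈ qs N) : S0 * (q : ℝ) ^ (-σ) ≤ (wOf mag q : ℝ) := by
  obtain ⟨hq1, hqN⟩ := mem_qs hq
  have hq1' : (1 : ℝ) ≤ q := by exact_mod_cast hq1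
  rw [wOf]
  push_cast
  calc (S0 : ℝ) * (q : ℝ) ^ (-σ) ≤ S0 * (q : ℝ) ^ (-sigLo ls js) :=
      mul_le_mul_of_nonneg_left (Real.rpow_le_rpow_of_exponent_le hq1' (by linarith))
        (Nat.cast_nonneg _)
    _ ≤ _ := hm.hi1 q hq1 (by omega)

include hc hm hN hL2 hL3 hL5 hσ1 hσ2 h2l h2u h3l h3u h5l h5u in
/-- **The enclosure of a group of `ζ_N`**: `S² G_q = U + L + E`, `|E| ≤ R2`. [folklore] -/
theorem group_spec (q : ℕ) (hok : (gOf c mag N q L2 L3 L5 a2 a3 a5).ok = true) :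
    ∃ E : ℂ, (S0 : ℂ) ^ 2 * G N q (zOf 2 σ θ₂) (zOf 3 σ θ₃) (zOf 5 σ θ₅) =
      Uof (gOf c mag N q L2 L3 L5 a2 a3 a5) +
        Lof (gOf c mag N q L2 L3 L5 a2 a3 a5) (θ₂ - thetaC L2 a2) (θ₃ - thetaC L3 a3)
          (θ₅ - thetaC L5 a5) + E ∧
      ‖E‖ ≤ ((summarize c (gOf c mag N q L2 L3 L5 a2 a3 a5)).R2 : ℝ) := by
  have hts : ∀ t ∈ Tq N q, 1 ≤ t.smooth ∧ t.smooth ≤ 28 := fun t ht ↦ by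
    have := mem_terms hN (List.mem_filter.1 ht).1
    exact ⟨this.2.2.2.1, this.2.2.2.2⟩
  obtain ⟨E, hE, hB⟩ := group_enclosure hc hm hL2 hL3 hL5 hσ1 hσ2 h2l h2u h3l h3u h5l h5u
    (Tq N q) GAcc.zero hts hok
  refine ⟨E, ?_, hB.trans ?_⟩
  · rw [G, ← Tq, hE, Uof, Lof, gOf, ctsOf]
    simp only [GAcc.zero, sub_zero]
    ring
  · refine le_trans (le_of_eq ?_) (R2_ge c _)
    simp [gOf, ctsOf, GAcc.zero]

include hc hm hN hL2 hL3 hL5 hσ1 hσ2 h2l h2u h3l h3u h5l h5u in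
/-- **Upper bound of a group with `U ≠ 0`**:
`Γ_q ≤ sp + LM²/(2 S² sm) + R2 + (δ₂A₂ + δ₃A₃ + δ₅A₅)/|U|`, `LM = h₂W₂ + h₃W₃ + h₅W₅`. [folklore] -/
theorem Gam_le_of_sm_ne (q : ℕ) (hok : (gOf c mag N q L2 L3 L5 a2 a3 a5).ok = true)
    (hsm : (summarize c (gOf c mag N q L2 L3 L5 a2 a3 a5)).sm ≠ 0) :
    Gam N q σ θ₂ θ₃ θ₅ ≤ ((summarize c (gOf c mag N q L2 L3 L5 a2 a3 a5)).sp : ℝ) +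
      ((hOf c L2 : ℝ) * (summarize c (gOf c mag N q L2 L3 L5 a2 a3 a5)).W2 +
        (hOf c L3 : ℝ) * (summarize c (gOf c mag N q L2 L3 L5 a2 a3 a5)).W3 +
        (hOf c L5 : ℝ) * (summarize c (gOf c mag N q L2 L3 L5 a2 a3 a5)).W5) ^ 2 /
        (2 * (S0 : ℝ) ^ 2 * (summarize c (gOf c mag N q L2 L3 L5 a2 a3 a5)).sm) +
      (summarize c (gOf c mag N q L2 L3 L5 a2 a3 a5)).R2 +
      ((θ₂ - thetaC L2 a2) * (summarize c (gOf c mag N q L2 L3 L5 a2 a3 a5)).A2 +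
        (θ₃ - thetaC L3 a3) * (summarize c (gOf c mag N q L2 L3 L5 a2 a3 a5)).A3 +
        (θ₅ - thetaC L5 a5) * (summarize c (gOf c mag N q L2 L3 L5 a2 a3 a5)).A5) /
        ‖Uof (gOf c mag N q L2 L3 L5 a2 a3 a5)‖ := by
  obtain ⟨E, hE, hB⟩ := group_spec hc hm hN hL2 hL3 hL5 hσ1 hσ2 h2l h2u h3l h3u h5l h5u q hok
  obtain ⟨hsm1, hsp⟩ := sm_le_norm_le_sp c (gOf c mag N q L2 L3 L5 a2 a3 a5)
  have hre := re_conj_U_L c (gOf c mag N q L2 L3 L5 a2 a3 a5) (θ₂ - thetaC L2 a2)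
    (θ₃ - thetaC L3 a3) (θ₅ - thetaC L5 a5)
  have hL := norm_L_le c (gOf c mag N q L2 L3 L5 a2 a3 a5) (abs_sub_mul_le hc h2l h2u)
    (abs_sub_mul_le hc h3l h3u) (abs_sub_mul_le hc h5l h5u)
  set g := gOf c mag N q L2 L3 L5 a2 a3 a5 with hg
  set s := summarize c g with hs
  have hsm0 : (1 : ℝ) ≤ s.sm := by exact_mod_cast Nat.one_le_iff_ne_zero.2 hsm
  have hU : 0 < ‖Uof g‖ := by linarith
  have hU0 : Uof g ≠ 0 := norm_pos_iff.1 hU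
  have hGam : Gam N q σ θ₂ θ₃ θ₅ = ‖Uof g + Lof g (θ₂ - thetaC L2 a2) (θ₃ - thetaC L3 a3)
      (θ₅ - thetaC L5 a5) + E‖ := by
    rw [Gam, ← hE, norm_mul, norm_pow, Complex.norm_natCast]
  rw [hGam]
  refine (norm_add_add_le' hU0 hB).trans ?_
  rw [hre]
  set LM : ℝ := (hOf c L2 : ℝ) * s.W2 + (hOf c L3 : ℝ) * s.W3 + (hOf c L5 : ℝ) * s.W5 with hLM
  have hS : (0 : ℝ) < S0 := by exact_mod_cast S0_pos
  have hL' : ‖Lof g (θ₂ - thetaC L2 a2) (θ₃ - thetaC L3 a3) (θ₅ - thetaC L5 a5)‖ ≤ LM / S0 := by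
    rw [le_div_iff₀ hS]; exact hL
  have hquad : ‖Lof g (θ₂ - thetaC L2 a2) (θ₃ - thetaC L3 a3) (θ₅ - thetaC L5 a5)‖ ^ 2 /
      (2 * ‖Uof g‖) ≤ LM ^ 2 / (2 * (S0 : ℝ) ^ 2 * s.sm) := by
    have h1 : ‖Lof g (θ₂ - thetaC L2 a2) (θ₃ - thetaC L3 a3) (θ₅ - thetaC L5 a5)‖ ^ 2 ≤
        (LM / S0) ^ 2 := pow_le_pow_left₀ (norm_nonneg _) hL' 2
    calc _ ≤ (LM / S0) ^ 2 / (2 * ‖Uof g‖) := div_le_div_of_nonneg_right h1 (by positivity)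
      _ ≤ (LM / S0) ^ 2 / (2 * s.sm) :=
          div_le_div_of_nonneg_left (by positivity) (by positivity) (by linarith)
      _ = LM ^ 2 / (2 * (S0 : ℝ) ^ 2 * s.sm) := by
          field_simp
  linarith

include hc hm hN hL2 hL3 hL5 hσ1 hσ2 h2l h2u h3l h3u h5l h5u in
/-- **Upper bound of a group with `U = 0`**: `Γ_q ≤ LM/S + R2`. [folklore] -/
theorem Gam_le_of_sm_eq (q : ℕ) (hok : (gOf c mag N q L2 L3 L5 a2 a3 a5).ok = true)
    (hsm : (summarize c (gOf c mag N q L2 L3 L5 a2 a3 a5)).sm = 0) :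
    Gam N q σ θ₂ θ₃ θ₅ ≤
      ((hOf c L2 : ℝ) * (summarize c (gOf c mag N q L2 L3 L5 a2 a3 a5)).W2 +
        (hOf c L3 : ℝ) * (summarize c (gOf c mag N q L2 L3 L5 a2 a3 a5)).W3 +
        (hOf c L5 : ℝ) * (summarize c (gOf c mag N q L2 L3 L5 a2 a3 a5)).W5) / S0 +
      (summarize c (gOf c mag N q L2 L3 L5 a2 a3 a5)).R2 := by
  obtain ⟨E, hE, hB⟩ := group_spec hc hm hN hL2 hL3 hL5 hσ1 hσ2 h2l h2u h3l h3u h5l h5u q hok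
  have hL := norm_L_le c (gOf c mag N q L2 L3 L5 a2 a3 a5) (abs_sub_mul_le hc h2l h2u)
    (abs_sub_mul_le hc h3l h3u) (abs_sub_mul_le hc h5l h5u)
  set g := gOf c mag N q L2 L3 L5 a2 a3 a5 with hg
  set s := summarize c g with hs
  -- `U = 0`
  have hn : (g.ux * g.ux + g.uy * g.uy).toNat = 0 := Nat.sqrt_eq_zero.1 hsm
  have hU : Uof g = 0 := by
    have h0 : g.ux * g.ux + g.uy * g.uy ≤ 0 := Int.toNat_eq_zero.1 hn
    have hx : g.ux = 0 := by nlinarith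
    have hy : g.uy = 0 := by nlinarith
    simp [Uof, gz, hx, hy]
  have hGam : Gam N q σ θ₂ θ₃ θ₅ = ‖Uof g + Lof g (θ₂ - thetaC L2 a2) (θ₃ - thetaC L3 a3)
      (θ₅ - thetaC L5 a5) + E‖ := by
    rw [Gam, ← hE, norm_mul, norm_pow, Complex.norm_natCast]
  rw [hGam, hU, zero_add]
  refine (norm_add_le _ _).trans ?_
  have hS : (0 : ℝ) < S0 := by exact_mod_cast S0_pos
  have hL' : ‖Lof g (θ₂ - thetaC L2 a2) (θ₃ - thetaC L3 a3) (θ₅ - thetaC L5 a5)‖ ≤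
      ((hOf c L2 : ℝ) * s.W2 + (hOf c L3 : ℝ) * s.W3 + (hOf c L5 : ℝ) * s.W5) / S0 := by
    rw [le_div_iff₀ hS]; exact hL
  linarith

include hc hm hN hL2 hL3 hL5 hσ1 hσ2 h2l h2u h3l h3u h5l h5u in
/-- **Lower bound of the unit group**: `sm − R2 + (δ₂A₂ + δ₃A₃ + δ₅A₅)/|U| ≤ Γ₁`. [folklore] -/
theorem Gam_ge (hok : (gOf c mag N 1 L2 L3 L5 a2 a3 a5).ok = true)
    (hsm : (summarize c (gOf c mag N 1 L2 L3 L5 a2 a3 a5)).sm ≠ 0) :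
    ((summarize c (gOf c mag N 1 L2 L3 L5 a2 a3 a5)).sm : ℝ) -
        (summarize c (gOf c mag N 1 L2 L3 L5 a2 a3 a5)).R2 +
      ((θ₂ - thetaC L2 a2) * (summarize c (gOf c mag N 1 L2 L3 L5 a2 a3 a5)).A2 +
        (θ₃ - thetaC L3 a3) * (summarize c (gOf c mag N 1 L2 L3 L5 a2 a3 a5)).A3 +
        (θ₅ - thetaC L5 a5) * (summarize c (gOf c mag N 1 L2 L3 L5 a2 a3 a5)).A5) /
        ‖Uof (gOf c mag N 1 L2 L3 L5 a2 a3 a5)‖ ≤ Gam N 1 σ θ₂ θ₃ θ₅ := by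
  obtain ⟨E, hE, hB⟩ := group_spec hc hm hN hL2 hL3 hL5 hσ1 hσ2 h2l h2u h3l h3u h5l h5u 1 hok
  obtain ⟨hsm1, hsp⟩ := sm_le_norm_le_sp c (gOf c mag N 1 L2 L3 L5 a2 a3 a5)
  have hre := re_conj_U_L c (gOf c mag N 1 L2 L3 L5 a2 a3 a5) (θ₂ - thetaC L2 a2)
    (θ₃ - thetaC L3 a3) (θ₅ - thetaC L5 a5)
  set g := gOf c mag N 1 L2 L3 L5 a2 a3 a5 with hg
  set s := summarize c g with hs
  have hsm0 : (1 : ℝ) ≤ s.sm := by exact_mod_cast Nat.one_le_iff_ne_zero.2 hsm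
  have hU : 0 < ‖Uof g‖ := by linarith
  have hU0 : Uof g ≠ 0 := norm_pos_iff.1 hU
  have hGam : Gam N 1 σ θ₂ θ₃ θ₅ = ‖Uof g + Lof g (θ₂ - thetaC L2 a2) (θ₃ - thetaC L3 a3)
      (θ₅ - thetaC L5 a5) + E‖ := by
    rw [Gam, ← hE, norm_mul, norm_pow, Complex.norm_natCast]
  rw [hGam]
  refine le_trans ?_ (norm_add_add_ge hU0 hB)
  rw [hre]
  linarith

include hc hm hN hL2 hL3 hL5 hσ1 hσ2 h2l h2u h3l h3u h5l h5u in
/-- **One step of the fold preserves the invariant** (and subtracts `S w_q Γ_q` from the budget).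
[folklore] -/
theorem stepGroup_inv {q : ℕ} (hq : q ∈ qs N) {e : EState} {X : ℝ}
    (hok : (gOf c mag N q L2 L3 L5 a2 a3 a5).ok = true)
    (hinv : Inv e (uOf L2 a2 θ₂) (uOf L3 a3 θ₃) (uOf L5 a5 θ₅) X) :
    Inv (stepGroup (hOf c L2) (hOf c L3) (hOf c L5) (wOf mag q)
        (summarize c (gOf c mag N q L2 L3 L5 a2 a3 a5)) e)
      (uOf L2 a2 θ₂) (uOf L3 a3 θ₃) (uOf L5 a5 θ₅)
      (X - S0 * (wOf mag q : ℝ) * Gam N q σ θ₂ θ₃ θ₅) := by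
  obtain ⟨c₂, c₃, c₅, b1, b2, b3, b4, b5, b6, hle⟩ := hinv
  have hS0 : (S0 : ℝ) = 268435456 := by norm_num [S0]
  have hw0 : (0 : ℝ) ≤ (wOf mag q : ℝ) := by
    have := w_ge hm hN hσ1 hq
    exact le_trans (by positivity) this
  have hGam0 : 0 ≤ Gam N q σ θ₂ θ₃ θ₅ := by rw [Gam]; positivity
  obtain ⟨hsm1, hsp⟩ := sm_le_norm_le_sp c (gOf c mag N q L2 L3 L5 a2 a3 a5)
  by_cases hsm : (summarize c (gOf c mag N q L2 L3 L5 a2 a3 a5)).sm = 0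
  · -- `U = 0`
    have hub := Gam_le_of_sm_eq hc hm hN hL2 hL3 hL5 hσ1 hσ2 h2l h2u h3l h3u h5l h5u q hok hsm
    unfold stepGroup
    rw [if_pos hsm]
    set s := summarize c (gOf c mag N q L2 L3 L5 a2 a3 a5) with hs
    set LMz : ℤ := (hOf c L2 : ℤ) * s.W2 + (hOf c L3 : ℤ) * s.W3 + (hOf c L5 : ℤ) * s.W5 with hLMz
    have hLM : (LMz : ℝ) = (hOf c L2 : ℝ) * s.W2 + (hOf c L3 : ℝ) * s.W3 + (hOf c L5 : ℝ) * s.W5 := by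
      rw [hLMz]; push_cast; ring
    have hcd : (LMz : ℝ) / ((268435456 : ℤ) : ℝ) ≤ (cdivZ LMz 268435456 : ℝ) :=
      Numerics.div_le_cdiv (by norm_num)
    push_cast at hcd
    rw [hLM, ← hS0] at hcd
    refine ⟨c₂, c₃, c₅, b1, b2, b3, b4, b5, b6, ?_⟩
    push_cast
    rw [hS0] at hub hcd ⊢
    have hprod : (268435456 : ℝ) * (wOf mag q : ℝ) * Gam N q σ θ₂ θ₃ θ₅ ≤
        (268435456 : ℝ) * (wOf mag q : ℝ) * ((cdivZ LMz 268435456 : ℝ) + s.R2) :=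
      mul_le_mul_of_nonneg_left (hub.trans (by linarith)) (by positivity)
    linarith
  · -- `U ≠ 0`
    have hub := Gam_le_of_sm_ne hc hm hN hL2 hL3 hL5 hσ1 hσ2 h2l h2u h3l h3u h5l h5u q hok hsm
    have hsmpos : 0 < (summarize c (gOf c mag N q L2 L3 L5 a2 a3 a5)).sm := Nat.pos_of_ne_zero hsm
    obtain ⟨l2, u2⟩ := loQ_le_le_hiQ (summarize c (gOf c mag N q L2 L3 L5 a2 a3 a5)).A2 hsmpos
      hsm1 hsp
    obtain ⟨l3, u3⟩ := loQ_le_le_hiQ (summarize c (gOf c mag N q L2 L3 L5 a2 a3 a5)).A3 hsmpos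
      hsm1 hsp
    obtain ⟨l5, u5⟩ := loQ_le_le_hiQ (summarize c (gOf c mag N q L2 L3 L5 a2 a3 a5)).A5 hsmpos
      hsm1 hsp
    unfold stepGroup
    rw [if_neg hsm]
    set g := gOf c mag N q L2 L3 L5 a2 a3 a5 with hg
    set s := summarize c g with hs
    set w : ℤ := wOf mag q with hw
    have hsm0 : (1 : ℝ) ≤ s.sm := by exact_mod_cast hsmpos
    have hU : 0 < ‖Uof g‖ := by linarith
    set LMz : ℤ := (hOf c L2 : ℤ) * s.W2 + (hOf c L3 : ℤ) * s.W3 + (hOf c L5 : ℤ) * s.W5 with hLMz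
    have hLM : (LMz : ℝ) = (hOf c L2 : ℝ) * s.W2 + (hOf c L3 : ℝ) * s.W3 + (hOf c L5 : ℝ) * s.W5 := by
      rw [hLMz]; push_cast; ring
    have hcd : ((LMz * LMz : ℤ) : ℝ) / ((2 * 268435456 * 268435456 * (s.sm : ℤ) : ℤ) : ℝ) ≤
        (cdivZ (LMz * LMz) (2 * 268435456 * 268435456 * s.sm) : ℝ) :=
      Numerics.div_le_cdiv (by push_cast; positivity)
    have hcd' : ((hOf c L2 : ℝ) * s.W2 + (hOf c L3 : ℝ) * s.W3 + (hOf c L5 : ℝ) * s.W5) ^ 2 /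
        (2 * (S0 : ℝ) ^ 2 * s.sm) ≤ (cdivZ (LMz * LMz) (2 * 268435456 * 268435456 * s.sm) : ℝ) := by
      refine le_trans (le_of_eq ?_) hcd
      push_cast
      rw [hS0, hLM]
      ring
    refine ⟨c₂ - (w : ℝ) * (s.A2 / ‖Uof g‖), c₃ - (w : ℝ) * (s.A3 / ‖Uof g‖),
      c₅ - (w : ℝ) * (s.A5 / ‖Uof g‖), ?_, ?_, ?_, ?_, ?_, ?_, ?_⟩
    · push_cast; linarith [mul_le_mul_of_nonneg_left u2 hw0]
    · push_cast; linarith [mul_le_mul_of_nonneg_left l2 hw0]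
    · push_cast; linarith [mul_le_mul_of_nonneg_left u3 hw0]
    · push_cast; linarith [mul_le_mul_of_nonneg_left l3 hw0]
    · push_cast; linarith [mul_le_mul_of_nonneg_left u5 hw0]
    · push_cast; linarith [mul_le_mul_of_nonneg_left l5 hw0]
    · push_cast
      rw [hS0] at hub hcd' ⊢
      -- `S w Γ ≤ S w UB + w Σ u A/|U|`
      have hprod : (268435456 : ℝ) * (w : ℝ) * Gam N q σ θ₂ θ₃ θ₅ ≤
          (268435456 : ℝ) * (w : ℝ) * ((s.sp : ℝ) +
            (cdivZ (LMz * LMz) (2 * 268435456 * 268435456 * s.sm) : ℝ) + s.R2 +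
            ((θ₂ - thetaC L2 a2) * s.A2 + (θ₃ - thetaC L3 a3) * s.A3 +
              (θ₅ - thetaC L5 a5) * s.A5) / ‖Uof g‖) :=
        mul_le_mul_of_nonneg_left (hub.trans (by linarith)) (by positivity)
      have hlin : (268435456 : ℝ) * (w : ℝ) * (((θ₂ - thetaC L2 a2) * s.A2 +
          (θ₃ - thetaC L3 a3) * s.A3 + (θ₅ - thetaC L5 a5) * s.A5) / ‖Uof g‖) =
          uOf L2 a2 θ₂ * ((w : ℝ) * (s.A2 / ‖Uof g‖)) +
          uOf L3 a3 θ₃ * ((w : ℝ) * (s.A3 / ‖Uof g‖)) +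
          uOf L5 a5 θ₅ * ((w : ℝ) * (s.A5 / ‖Uof g‖)) := by
        simp only [uOf, hS0]; field_simp
      have hexp : (268435456 : ℝ) * (w : ℝ) * ((s.sp : ℝ) +
            (cdivZ (LMz * LMz) (2 * 268435456 * 268435456 * s.sm) : ℝ) + s.R2 +
            ((θ₂ - thetaC L2 a2) * s.A2 + (θ₃ - thetaC L3 a3) * s.A3 +
              (θ₅ - thetaC L5 a5) * s.A5) / ‖Uof g‖) =
          (268435456 : ℝ) * (w : ℝ) * ((s.sp : ℝ) +
            (cdivZ (LMz * LMz) (2 * 268435456 * 268435456 * s.sm) : ℝ) + s.R2) +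
          (uOf L2 a2 θ₂ * ((w : ℝ) * (s.A2 / ‖Uof g‖)) +
          uOf L3 a3 θ₃ * ((w : ℝ) * (s.A3 / ‖Uof g‖)) +
          uOf L5 a5 θ₅ * ((w : ℝ) * (s.A5 / ‖Uof g‖))) := by
        rw [← hlin]; ring
      rw [hexp] at hprod
      linarith

include hc hm hN hL2 hL3 hL5 hσ1 hσ2 h2l h2u h3l h3u h5l h5u in
/-- **The fold preserves the invariant.** [folklore] -/
theorem stepGroups_inv :
    ∀ (Q : List ℕ) (e : EState) (X : ℝ), (∀ q ∈ Q, q ∈ qs N) →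
      (stepGroups c (midOf L2 a2) (midOf L3 a3) (midOf L5 a5) (hOf c L2) (hOf c L3) (hOf c L5)
        (Q.map fun q ↦ (wOf mag q, ctsOf mag N q)) e).ok = true →
      Inv e (uOf L2 a2 θ₂) (uOf L3 a3 θ₃) (uOf L5 a5 θ₅) X →
      Inv (stepGroups c (midOf L2 a2) (midOf L3 a3) (midOf L5 a5) (hOf c L2) (hOf c L3) (hOf c L5)
          (Q.map fun q ↦ (wOf mag q, ctsOf mag N q)) e)
        (uOf L2 a2 θ₂) (uOf L3 a3 θ₃) (uOf L5 a5 θ₅)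
        (X - (Q.map fun q ↦ (S0 : ℝ) * (wOf mag q : ℝ) * Gam N q σ θ₂ θ₃ θ₅).sum)
  | [], e, X, _, _, hinv => by simpa [stepGroups] using hinv
  | q :: Q, e, X, hQ, hok, hinv => by
    rw [List.map_cons, stepGroups] at hok ⊢
    have hq : q ∈ qs N := hQ q List.mem_cons_self
    have hok1 : (gOf c mag N q L2 L3 L5 a2 a3 a5).ok = true := by
      have h1 := (stepGroups_ok _ _ hok).1
      unfold stepGroup at h1
      split_ifs at h1
      · simp only [Bool.and_eq_true] at h1; exact h1.2
      · simp only [Bool.and_eq_true] at h1; exact h1.2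
    have h1 := stepGroup_inv hc hm hN hL2 hL3 hL5 hσ1 hσ2 h2l h2u h3l h3u h5l h5u hq hok1 hinv
    have h2 := stepGroups_inv Q _ _ (fun q' hq' ↦ hQ q' (List.mem_cons_of_mem _ hq')) hok h1
    rw [List.map_cons, List.sum_cons, show X - ((S0 : ℝ) * (wOf mag q : ℝ) * Gam N q σ θ₂ θ₃ θ₅ +
      (Q.map fun q ↦ (S0 : ℝ) * (wOf mag q : ℝ) * Gam N q σ θ₂ θ₃ θ₅).sum) =
      X - (S0 : ℝ) * (wOf mag q : ℝ) * Gam N q σ θ₂ θ₃ θ₅ -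
      (Q.map fun q ↦ (S0 : ℝ) * (wOf mag q : ℝ) * Gam N q σ θ₂ θ₃ θ₅).sum by ring]
    exact h2

/-- `|c| ≤ max |lo| |hi|` for `lo ≤ c ≤ hi`. [folklore] -/
theorem abs_le_max_zabs {lo hi : ℤ} {x : ℝ} (h1 : (lo : ℝ) ≤ x) (h2 : x ≤ hi) :
    |x| ≤ ((max (zabs lo) (zabs hi) : ℤ) : ℝ) := by
  have e1 : ((zabs lo : ℤ) : ℝ) = |(lo : ℝ)| := by rw [zabs, Int.cast_natCast, Nat.cast_natAbs, Int.cast_abs]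
  have e2 : ((zabs hi : ℤ) : ℝ) = |(hi : ℝ)| := by rw [zabs, Int.cast_natCast, Nat.cast_natAbs, Int.cast_abs]
  rw [Int.cast_max, e1, e2, abs_le]
  constructor
  · have : |(lo : ℝ)| ≤ max |(lo : ℝ)| |(hi : ℝ)| := le_max_left _ _
    linarith [neg_abs_le (lo : ℝ)]
  · have : |(hi : ℝ)| ≤ max |(lo : ℝ)| |(hi : ℝ)| := le_max_right _ _
    linarith [le_abs_self (hi : ℝ)]

/-- `u c ≥ −h C` when `|u| ≤ h` and `|c| ≤ C`. [folklore] -/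
theorem mul_ge_neg {u cc h C : ℝ} (hu : |u| ≤ h) (hc : |cc| ≤ C) : -(h * C) ≤ u * cc := by
  have : |u * cc| ≤ h * C := by
    rw [abs_mul]; exact mul_le_mul hu hc (abs_nonneg _) (le_trans (abs_nonneg _) hu)
  linarith [neg_abs_le (u * cc)]

include hc hm hN hL2 hL3 hL5 hσ1 hσ2 h2l h2u h3l h3u h5l h5u in
/-- The accepting branch of the box evaluation implies the claim at the point. [folklore] -/
theorem pass_sound
    (hsm : ¬ (groupSum c (midOf L2 a2) (midOf L3 a3) (midOf L5 a5) (hOf c L2) (hOf c L3) (hOf c L5)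
      (ctsOf mag N 1)).sm = 0)
    (h : passOf (hOf c L2) (hOf c L3) (hOf c L5)
      (stepGroups c (midOf L2 a2) (midOf L3 a3) (midOf L5 a5) (hOf c L2) (hOf c L3) (hOf c L5)
        (((qs N).filter fun q ↦ q ≠ 1).map fun q ↦ (wOf mag q, ctsOf mag N q))
        (e0Of (groupSum c (midOf L2 a2) (midOf L3 a3) (midOf L5 a5) (hOf c L2) (hOf c L3) (hOf c L5)
          (ctsOf mag N 1)))) = true) :
    R N σ (zOf 2 σ θ₂) (zOf 3 σ θ₃) (zOf 5 σ θ₅) < ‖G N 1 (zOf 2 σ θ₂) (zOf 3 σ θ₃) (zOf 5 σ θ₅)‖ := by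
  -- notation
  set s := groupSum c (midOf L2 a2) (midOf L3 a3) (midOf L5 a5) (hOf c L2) (hOf c L3) (hOf c L5)
    (ctsOf mag N 1) with hs
  have hs' : s = summarize c (gOf c mag N 1 L2 L3 L5 a2 a3 a5) := rfl
  set qs' := (qs N).filter fun q ↦ q ≠ 1 with hqs'
  set e := stepGroups c (midOf L2 a2) (midOf L3 a3) (midOf L5 a5) (hOf c L2) (hOf c L3) (hOf c L5)
    (qs'.map fun q ↦ (wOf mag q, ctsOf mag N q)) (e0Of s) with he
  simp only [passOf, Bool.and_eq_true, decide_eq_true_eq] at h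
  obtain ⟨hok, hlin⟩ := h
  -- the unit group
  have hok0 : (gOf c mag N 1 L2 L3 L5 a2 a3 a5).ok = true := (stepGroups_ok _ _ hok).1
  rw [hs'] at hsm
  have hlow := Gam_ge hc hm hN hL2 hL3 hL5 hσ1 hσ2 h2l h2u h3l h3u h5l h5u hok0 hsm
  obtain ⟨hsm1, hsp⟩ := sm_le_norm_le_sp c (gOf c mag N 1 L2 L3 L5 a2 a3 a5)
  have hsmpos : 0 < (summarize c (gOf c mag N 1 L2 L3 L5 a2 a3 a5)).sm := Nat.pos_of_ne_zero hsm
  obtain ⟨l2, u2⟩ := loQ_le_le_hiQ (summarize c (gOf c mag N 1 L2 L3 L5 a2 a3 a5)).A2 hsmpos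
    hsm1 hsp
  obtain ⟨l3, u3⟩ := loQ_le_le_hiQ (summarize c (gOf c mag N 1 L2 L3 L5 a2 a3 a5)).A3 hsmpos
    hsm1 hsp
  obtain ⟨l5, u5⟩ := loQ_le_le_hiQ (summarize c (gOf c mag N 1 L2 L3 L5 a2 a3 a5)).A5 hsmpos
    hsm1 hsp
  rw [← hs'] at hlow hsm1 hsp l2 u2 l3 u3 l5 u5 hsmpos
  have hS0 : (S0 : ℝ) = 268435456 := by norm_num [S0]
  have hSpos : (0 : ℝ) < 268435456 := by norm_num
  set U1 := Uof (gOf c mag N 1 L2 L3 L5 a2 a3 a5) with hU1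
  have hsm0 : (1 : ℝ) ≤ s.sm := by exact_mod_cast hsmpos
  have hU : 0 < ‖U1‖ := by linarith
  -- the initial invariant
  have hinv0 : Inv (e0Of s) (uOf L2 a2 θ₂) (uOf L3 a3 θ₃) (uOf L5 a5 θ₅)
      ((S0 : ℝ) ^ 2 * Gam N 1 σ θ₂ θ₃ θ₅) := by
    refine ⟨268435456 * (s.A2 / ‖U1‖), 268435456 * (s.A3 / ‖U1‖), 268435456 * (s.A5 / ‖U1‖),
      ?_, ?_, ?_, ?_, ?_, ?_, ?_⟩
    · simp only [e0Of]; push_cast; linarith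
    · simp only [e0Of]; push_cast; linarith
    · simp only [e0Of]; push_cast; linarith
    · simp only [e0Of]; push_cast; linarith
    · simp only [e0Of]; push_cast; linarith
    · simp only [e0Of]; push_cast; linarith
    · simp only [e0Of]
      push_cast
      rw [hS0]
      have hmul : (268435456 : ℝ) ^ 2 * ((s.sm : ℝ) - s.R2 +
          ((θ₂ - thetaC L2 a2) * s.A2 + (θ₃ - thetaC L3 a3) * s.A3 + (θ₅ - thetaC L5 a5) * s.A5) /
            ‖U1‖) ≤ (268435456 : ℝ) ^ 2 * Gam N 1 σ θ₂ θ₃ θ₅ :=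
        mul_le_mul_of_nonneg_left hlow (by positivity)
      have hexp : (268435456 : ℝ) ^ 2 * ((s.sm : ℝ) - s.R2 +
          ((θ₂ - thetaC L2 a2) * s.A2 + (θ₃ - thetaC L3 a3) * s.A3 + (θ₅ - thetaC L5 a5) * s.A5) /
            ‖U1‖) = 268435456 * (268435456 * ((s.sm : ℝ) - s.R2)) +
          uOf L2 a2 θ₂ * (268435456 * (s.A2 / ‖U1‖)) + uOf L3 a3 θ₃ * (268435456 * (s.A3 / ‖U1‖)) +
          uOf L5 a5 θ₅ * (268435456 * (s.A5 / ‖U1‖)) := by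
        simp only [uOf, hS0]; field_simp; ring
      linarith
  -- the fold
  have hqs : ∀ q ∈ qs', q ∈ qs N := fun q hq ↦ (List.mem_filter.1 hq).1
  have hinv := stepGroups_inv hc hm hN hL2 hL3 hL5 hσ1 hσ2 h2l h2u h3l h3u h5l h5u qs' (e0Of s) _
    hqs hok hinv0
  rw [← he] at hinv
  obtain ⟨c₂, c₃, c₅, b1, b2, b3, b4, b5, b6, hle⟩ := hinv
  -- the linear terms are at least `-lin`
  have k2 := mul_ge_neg (abs_uOf_le hc h2l h2u) (abs_le_max_zabs b1 b2)
  have k3 := mul_ge_neg (abs_uOf_le hc h3l h3u) (abs_le_max_zabs b3 b4)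
  have k5 := mul_ge_neg (abs_uOf_le hc h5l h5u) (abs_le_max_zabs b5 b6)
  have hlin' : (linOf (hOf c L2) (hOf c L3) (hOf c L5) e : ℝ) < e.total := by exact_mod_cast hlin
  simp only [linOf] at hlin'
  push_cast at hlin'
  -- so `0 < S² Γ₁ − Σ S w_q Γ_q`
  have hpos : 0 < (S0 : ℝ) ^ 2 * Gam N 1 σ θ₂ θ₃ θ₅ -
      (qs'.map fun q ↦ (S0 : ℝ) * (wOf mag q : ℝ) * Gam N q σ θ₂ θ₃ θ₅).sum := by
    push_cast [Int.cast_max] at k2 k3 k5 hle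
    linarith
  -- compare the weights with `S q^{-σ}`
  have hsum : (qs'.map fun q : ℕ ↦ (S0 : ℝ) * ((S0 : ℝ) * (q : ℝ) ^ (-σ)) * Gam N q σ θ₂ θ₃ θ₅).sum ≤
      (qs'.map fun q ↦ (S0 : ℝ) * (wOf mag q : ℝ) * Gam N q σ θ₂ θ₃ θ₅).sum := by
    refine List.sum_le_sum fun q hq ↦ ?_
    have hw := w_ge hm hN hσ1 (hqs q hq)
    have hG : 0 ≤ Gam N q σ θ₂ θ₃ θ₅ := by rw [Gam]; positivity
    have hS : (0 : ℝ) ≤ S0 := Nat.cast_nonneg _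
    exact mul_le_mul_of_nonneg_right (mul_le_mul_of_nonneg_left hw hS) hG
  have hR : (qs'.map fun q : ℕ ↦ (S0 : ℝ) * ((S0 : ℝ) * (q : ℝ) ^ (-σ)) * Gam N q σ θ₂ θ₃ θ₅).sum =
      (S0 : ℝ) ^ 4 * R N σ (zOf 2 σ θ₂) (zOf 3 σ θ₃) (zOf 5 σ θ₅) := by
    rw [R, ← hqs', ← List.sum_map_mul_left]
    congr 1
    refine List.map_congr_left fun q _ ↦ ?_
    simp only [Gam]
    ring
  have hG1 : (S0 : ℝ) ^ 2 * Gam N 1 σ θ₂ θ₃ θ₅ =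
      (S0 : ℝ) ^ 4 * ‖G N 1 (zOf 2 σ θ₂) (zOf 3 σ θ₃) (zOf 5 σ θ₅)‖ := by
    rw [Gam]; ring
  have hS4 : (0 : ℝ) < (S0 : ℝ) ^ 4 := by rw [hS0]; positivity
  have key : (S0 : ℝ) ^ 4 * R N σ (zOf 2 σ θ₂) (zOf 3 σ θ₃) (zOf 5 σ θ₅) <
      (S0 : ℝ) ^ 4 * ‖G N 1 (zOf 2 σ θ₂) (zOf 3 σ θ₃) (zOf 5 σ θ₅)‖ := by
    rw [← hR, ← hG1]; linarith
  exact lt_of_mul_lt_mul_left key hS4.le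

include hc hm hN1 hN hL2 hL3 hL5 hσ1 hσ2 h2l h2u h3l h3u h5l h5u in
/-- **Soundness of the box evaluation**: an accepted box satisfies the claim at every point of
the box. [cite: PlattTrudgian2016, §2.2] -/
theorem evalBox_sound (h : (evalBox c (compileGroups mag (groupsOf N)) L2 L3 L5 a2 a3 a5).1 = true) :
    R N σ (zOf 2 σ θ₂) (zOf 3 σ θ₃) (zOf 5 σ θ₅) < ‖G N 1 (zOf 2 σ θ₂) (zOf 3 σ θ₃) (zOf 5 σ θ₅)‖ := by
  rw [compileGroups_groupsOf hN1] at h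
  simp only [evalBox] at h
  split_ifs at h with hsm
  exact pass_sound hc hm hN hL2 hL3 hL5 hσ1 hσ2 h2l h2u h3l h3u h5l h5u hsm h

end Eval

/-! ## Soundness of the search -/

/-- Halving an arc: the left half. [folklore] -/
theorem arc_left {L a : ℕ} {θ : ℝ} (hl : 2 * Real.pi * a / 2 ^ L ≤ θ)
    (hm : θ ≤ 2 * Real.pi * ((2 * a : ℕ) + 1) / 2 ^ (L + 1)) :
    2 * Real.pi * ((2 * a : ℕ) : ℝ) / 2 ^ (L + 1) ≤ θ ∧ θ ≤ 2 * Real.pi * ((2 * a : ℕ) + 1) / 2 ^ (L + 1) := by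
  refine ⟨le_trans (le_of_eq ?_) hl, hm⟩
  push_cast; rw [pow_succ]; ring

/-- Halving an arc: the right half. [folklore] -/
theorem arc_right {L a : ℕ} {θ : ℝ} (hm : 2 * Real.pi * ((2 * a : ℕ) + 1) / 2 ^ (L + 1) ≤ θ)
    (hu : θ ≤ 2 * Real.pi * (a + 1) / 2 ^ L) :
    2 * Real.pi * ((2 * a + 1 : ℕ) : ℝ) / 2 ^ (L + 1) ≤ θ ∧
      θ ≤ 2 * Real.pi * ((2 * a + 1 : ℕ) + 1) / 2 ^ (L + 1) := by
  refine ⟨le_trans (le_of_eq ?_) hm, hu.trans (le_of_eq ?_)⟩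
  · push_cast; ring
  · push_cast; rw [pow_succ]; ring

/-- **Soundness of the search**: if the bisection accepts a box (valid magnitude table, angle levels
`≤ 13`), the claim holds at every point of the box. Induction on the fuel: an accepted box is
`evalBox_sound`; otherwise the two children (in `σ`, by `magLeft_valid`/`magRight_valid`, or in an
angle) cover the box. [cite: PlattTrudgian2016, §2.2] -/
theorem search_sound {c : Ctx} (hc : c.Valid) {N : ℕ} (hN1 : 1 ≤ N) (hN : N ≤ 28) (b : Bool) :
    ∀ (fuel : ℕ) {ls js : ℕ} {mag : Array (ℕ × ℕ × ℕ × ℕ)} {L2 L3 L5 a2 a3 a5 : ℕ},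
      MagValid ls js mag → L2 ≤ 13 → L3 ≤ 13 → L5 ≤ 13 →
      search c (groupsOf N) b fuel ls mag (compileGroups mag (groupsOf N)) L2 L3 L5 a2 a3 a5 = true →
      ∀ {σ θ₂ θ₃ θ₅ : ℝ}, sigLo ls js ≤ σ → σ ≤ sigHi ls js →
        2 * Real.pi * a2 / 2 ^ L2 ≤ θ₂ → θ₂ ≤ 2 * Real.pi * (a2 + 1) / 2 ^ L2 →
        2 * Real.pi * a3 / 2 ^ L3 ≤ θ₃ → θ₃ ≤ 2 * Real.pi * (a3 + 1) / 2 ^ L3 →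
        2 * Real.pi * a5 / 2 ^ L5 ≤ θ₅ → θ₅ ≤ 2 * Real.pi * (a5 + 1) / 2 ^ L5 →
        R N σ (zOf 2 σ θ₂) (zOf 3 σ θ₃) (zOf 5 σ θ₅) <
          ‖G N 1 (zOf 2 σ θ₂) (zOf 3 σ θ₃) (zOf 5 σ θ₅)‖ := by
  intro fuel
  induction fuel with
  | zero =>
    intro ls js mag L2 L3 L5 a2 a3 a5 hm hL2 hL3 hL5 h σ θ₂ θ₃ θ₅ hσ1 hσ2 h2l h2u h3l h3u h5l h5u
    rw [search] at h
    exact evalBox_sound hc hm hN1 hN hL2 hL3 hL5 hσ1 hσ2 h2l h2u h3l h3u h5l h5u h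
  | succ n ih =>
    intro ls js mag L2 L3 L5 a2 a3 a5 hm hL2 hL3 hL5 h σ θ₂ θ₃ θ₅ hσ1 hσ2 h2l h2u h3l h3u h5l h5u
    rw [search, Bool.or_eq_true] at h
    rcases h with h | h
    · exact evalBox_sound hc hm hN1 hN hL2 hL3 hL5 hσ1 hσ2 h2l h2u h3l h3u h5l h5u h
    split at h
    · exact absurd h Bool.false_ne_true
    · -- `σ` split
      rw [Bool.and_eq_true] at h
      obtain ⟨hL, hR⟩ := h
      rcases le_total σ ((sigLo ls js + sigHi ls js) / 2) with hσ | hσ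
      · exact ih (magLeft_valid hm) hL2 hL3 hL5 hL (by rw [sigLo_left]; exact hσ1)
          (by rw [sigHi_left]; exact hσ) h2l h2u h3l h3u h5l h5u
      · exact ih (magRight_valid hm) hL2 hL3 hL5 hR (by rw [sigLo_right]; exact hσ)
          (by rw [sigHi_right]; exact hσ2) h2l h2u h3l h3u h5l h5u
    · -- `θ₂` split
      simp only [Bool.and_eq_true, decide_eq_true_eq] at h
      obtain ⟨hlev, hL, hR⟩ := h
      have hL2' : L2 + 1 ≤ 13 := by rw [M] at hlev; omega
      rcases le_total θ₂ (2 * Real.pi * ((2 * a2 : ℕ) + 1) / 2 ^ (L2 + 1)) with hθ | hθ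
      · obtain ⟨e1, e2⟩ := arc_left h2l hθ
        exact ih hm hL2' hL3 hL5 hL hσ1 hσ2 e1 e2 h3l h3u h5l h5u
      · obtain ⟨e1, e2⟩ := arc_right hθ h2u
        exact ih hm hL2' hL3 hL5 hR hσ1 hσ2 e1 e2 h3l h3u h5l h5u
    · -- `θ₃` split
      simp only [Bool.and_eq_true, decide_eq_true_eq] at h
      obtain ⟨hlev, hL, hR⟩ := h
      have hL3' : L3 + 1 ≤ 13 := by rw [M] at hlev; omega
      rcases le_total θ₃ (2 * Real.pi * ((2 * a3 : ℕ) + 1) / 2 ^ (L3 + 1)) with hθ | hθ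
      · obtain ⟨e1, e2⟩ := arc_left h3l hθ
        exact ih hm hL2 hL3' hL5 hL hσ1 hσ2 h2l h2u e1 e2 h5l h5u
      · obtain ⟨e1, e2⟩ := arc_right hθ h3u
        exact ih hm hL2 hL3' hL5 hR hσ1 hσ2 h2l h2u e1 e2 h5l h5u
    · -- `θ₅` split
      simp only [Bool.and_eq_true, decide_eq_true_eq] at h
      obtain ⟨hlev, hL, hR⟩ := h
      have hL5' : L5 + 1 ≤ 13 := by rw [M] at hlev; omega
      rcases le_total θ₅ (2 * Real.pi * ((2 * a5 : ℕ) + 1) / 2 ^ (L5 + 1)) with hθ | hθ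
      · obtain ⟨e1, e2⟩ := arc_left h5l hθ
        exact ih hm hL2 hL3 hL5' hL hσ1 hσ2 h2l h2u h3l h3u e1 e2
      · obtain ⟨e1, e2⟩ := arc_right hθ h5u
        exact ih hm hL2 hL3 hL5' hR hσ1 hσ2 h2l h2u h3l h3u e1 e2

end BoxCert

end Literature.Barriers.RiemannHypothesis
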